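import Literature.Barriers.CriticalPhenomena.PlaquetteWalkIsthmusRoot
import HarnessLib

/-!
# Barrier catalogue (SAWScalingLimit): the DOMINO (two-plaquette) technique class of the five-weight
plaquette walk on `ℤ²` — definitions, the six two-plaquette rows, their necessity, and GENERIC TRIVIALITY

After the one-plaquette technique classes (classified on all of `ℂ⁵ × {t ≠ 0}` in
`PlaquetteWalkSpinRigidity` … `PlaquetteWalkDegenerateIdentity`), the next template of the venture lane's
certified search is the DOMINO: two horizontally adjacent plaquettes `f`, `f⁺ = f + (1,0)` with their seven
distinct sides in the slot order `(f.W, f.N, f.S, shared = f.E = f⁺.W, f⁺.N, f⁺.S, f⁺.E) ↦ (0, …, 6)`; a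
relation is `Σ_{s<7} c_s F(z_s) = 0` with a CONSTANT `c ∈ ℂ⁷`, demanded at every domino of every finite
face list for every boundary root (hole roots included): `ExactDominoVertexRelation W t c`. This file is
the walk-free half of the theory (imports only `PlaquetteWalkIsthmusRoot`); the companion
`PlaquetteWalkDominoIdentity` proves, on top of `PlaquetteWalkDegenerateIdentity`, that the directed
hyperplanes DO carry the identities whose coefficient vectors are introduced here.

* § Definitions: `dominoSlot`, `dominoFunctional`, `ExactDominoVertexRelation`; ★ `dominoFunctional_eq_add`
  (the domino functional = two one-plaquette vertex functionals, for any splitting of the shared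
  coefficient) ⇒ `exactDominoVertexRelation_of_plaquette` (translates); the plaquette row `plaqRow` and the
  SIX TWO-PLAQUETTE ROWS `DominoRows` (rows of the dressed vectors `dressL` / `dressR`).
* § Closed forms: `branchDominoCoeff u₂ v t = (vK₊, −u₂tK₋, −2u₂vt, K₋K₊, −2u₂vt, −u₂tK₋, vK₊)`
  (`K± = u₂² − v² ± 1`) kills the six rows on `u₁ = 0`; `branchDominoCoeffMirror u₁ v t` on `u₂ = 0`;
  both nonzero off two quartic points.
* § Necessity: ★ `dominoRows_of_exactDominoVertexRelation` — for EVERY `W ∈ ℂ⁵`, `t ≠ 0` an exact domino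
  relation forces the six rows (bare domino `[(0,0),(1,0)]`, six boundary roots; twelve `decide` instances
  of the certified enumerator `termsN`, read through `vertexFunctional_mul_pow_eq_rowSumN`).
* § The row space on the branches, solved: off the one-plaquette quartic the rows say `c` is symmetric
  under the half-turn of the domino and proportional to the closed-form vector
  (`dominoRows_iff_sym_of_u₁/u₂_eq_zero`, `dominoRows_proportional_of_u₁/u₂_eq_zero`; the antisymmetric
  part dies because its `2 × 2` determinant IS the quartic).
* § GENERIC TRIVIALITY: under the half-turn the unknown splits into antisymmetric / symmetric parts; the
  cleared rows give a `3 × 3` antisymmetric system with determinant `t² · dominoDetA` (13 terms) and, with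
  one `2 × 2`-block instance and its half-turn image (walks circling the block, doubling a corner
  plaquette — weight `w₁`), a `4 × 4` symmetric system with determinant `2u₁²u₂t³ · dominoDetS` (21 terms);
  ★★ `eq_zero_of_exactDominoVertexRelation`: `u₁u₂ ≠ 0`, `t ≠ 0`, `dominoDetA ≠ 0`, `dominoDetS ≠ 0` ⇒ every
  exact domino relation is trivial (adjugate certificates by `ring`); ★★ named
  `PlaquetteWalkDominoGenericTriviality(_holds)`: a nonzero two-plaquette identity with `u₁u₂ ≠ 0` lies on
  the explicit hypersurface `{dominoDetA = 0} ∪ {dominoDetS = 0}`; ★ `saw_domino_trivial`: the uniform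
  self-avoiding walk `(x,x,x,0,0)` carries no two-plaquette identity off two explicit curves in the
  `(x, t)`-plane (`dominoDetA_saw`, `dominoDetS_saw`) — the five-weight-frame counterpart, with explicit
  exceptional curves, of the tree's `NoExactDominoRelationZ2`. On `u₁ = 0`, `dominoDetA = t⁴ ·` quartic.

Sources: [cite: GlazmanManolescu2019, §1 Fig. 1, eq. (1); §2.1; Lemma 2.1 (shape of a local relation and
its proof by grouping the walks at a rhombus)]; [cite: Glazman2015WeightedSAW, Lemma 3.1 (the one-rhombus
linear system: necessity "solving this linear system", eq. (3.11))]; [cite: IkhlefCardy2009, §3 (the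
one-plaquette system and its determinant)]; [cite: DuminilCopinSmirnov2012, Lemma 1]; [cite:
JansevanRensburg2015, §4.6 (Temperley method for partially directed walks, eq. (4.197), Fig. 4.24)].
Status in print: the one-plaquette systems/determinants are printed; the two-plaquette rows, determinants,
necessity and generic triviality, the solved branch row spaces and the SAW curves are the venture lane's
(«pcv-sawmu», Tier B SEARCH 1, b-engine-1 gen 14; HOME/FINDING-Z2-DOMINO-CLASS.md) — NEW-IN-WRITING
(modest) statements / CONSOLIDATION of method; label owed. Not claimed: that the exceptional hypersurface
carries identities off the known families — the condition is sufficient for triviality, not sharp (further block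
instances cut the hypersurface down; the lane's referee face finds the full system trivial at sampled points
of `dominoDetS = 0`).
-/

noncomputable section

open Complex

namespace Literature.Barriers.CriticalPhenomena

open Literature.Probability.RandomPlanarGeometry.SAW.YangBaxter

namespace PlaquetteWalk

open private vertexFunctional_mul_pow_eq_rowSumN from
  Literature.Barriers.CriticalPhenomena.PlaquetteWalkSpinRigidity

/-! ### The domino: slots, functional, technique class -/

/-- The eastern neighbour `f⁺ = f + (1, 0)` of a plaquette. [cite: GlazmanManolescu2019, §1 (columns k, k+1)] -/
def east (f : Face) : Face := (f.1 + 1, f.2)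

/-- The shared side: the east side of `f` is the west side of `f⁺`. [cite: GlazmanManolescu2019, §1 ("vert k j is the left side of face (k, j), the right side of (k−1, j)")] -/
theorem side_E_eq_east_side_W (f : Face) : f.side .E = (east f).side .W := rfl

/-- The seven sides of the horizontal domino `{f, f⁺}` in slot order
`(f.W, f.N, f.S, shared, f⁺.N, f⁺.S, f⁺.E) ↦ (0, 1, 2, 3, 4, 5, 6)`. [cite: GlazmanManolescu2019, §2.1, Fig. 4 (z_W, z_E, z_S, z_N of a rhombus)] -/
def dominoSlot (f : Face) : Fin 7 → MidEdge :=
  ![f.side .W, f.side .N, f.side .S, f.side .E, (east f).side .N, (east f).side .S, (east f).side .E]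

/-- **The domino functional** `Σ_{s < 7} c_s F(z_s)` over the seven sides of the domino `{f, f⁺}` — the
two-plaquette analogue of `vertexFunctional`. [cite: DuminilCopinSmirnov2012, Lemma 1 (shape of a local linear relation among observable values)] -/
def dominoFunctional (W : CWeights) (t : ℂ) (c : Fin 7 → ℂ) (Dl : List Face) (a : MidEdge) (f : Face) : ℂ :=
  ∑ s : Fin 7, c s * gmObservable W t Dl a (dominoSlot f s)

/-- **Technique class** `ExactDominoVertexRelation W t c`: the plaquette walk with weights `W` and phase `t`
per left quarter turn satisfies the domino relation with the CONSTANT coefficients `c ∈ ℂ⁷` at EVERY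
horizontal domino `{f, f⁺} ⊆ D` of EVERY finite face list for EVERY boundary root (hole roots included).
[cite: GlazmanManolescu2019, Lemma 2.1 (shape: a relation at each rhombus of the domain — here at each pair of adjacent rhombi)] -/
def ExactDominoVertexRelation (W : CWeights) (t : ℂ) (c : Fin 7 → ℂ) : Prop :=
  ∀ (Dl : List Face) (a : MidEdge) (f : Face), f ∈ Dl → east f ∈ Dl → IsBoundaryRoot Dl a →
    dominoFunctional W t c Dl a f = 0

/-! ### The domino functional is a sum of two one-plaquette functionals -/

/-- Left one-plaquette coefficient vector `(γ₁, c_N, c_W, c_S)` (slot order `(E, N, W, S)` at `f`).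
[cite: DuminilCopinSmirnov2012, Lemma 1 (shape of the one-vertex relation)] -/
def leftCoeff (c : Fin 7 → ℂ) (γ₁ : ℂ) : Fin 4 → ℂ := ![γ₁, c 1, c 0, c 2]

/-- Right one-plaquette coefficient vector `(c_E⁺, c_N⁺, γ₂, c_S⁺)` (slot order `(E, N, W, S)` at `f⁺`).
[cite: DuminilCopinSmirnov2012, Lemma 1 (shape of the one-vertex relation)] -/
def rightCoeff (c : Fin 7 → ℂ) (γ₂ : ℂ) : Fin 4 → ℂ := ![c 6, c 4, γ₂, c 5]

/-- ★ **Splitting**: for any `γ₁ + γ₂ = c_shared`, the domino functional is the vertex functional of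
`(γ₁, c_N, c_W, c_S)` at `f` plus the vertex functional of `(c_E⁺, c_N⁺, γ₂, c_S⁺)` at `f⁺`.
[cite: DuminilCopinSmirnov2012, Lemma 1 (linear in the coefficients)] -/
theorem dominoFunctional_eq_add (W : CWeights) (t : ℂ) (c : Fin 7 → ℂ) (Dl : List Face) (a : MidEdge)
    (f : Face) {γ₁ γ₂ : ℂ} (h : γ₁ + γ₂ = c 3) :
    dominoFunctional W t c Dl a f =
      vertexFunctional W t (leftCoeff c γ₁) Dl a f + vertexFunctional W t (rightCoeff c γ₂) Dl a (east f) := by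
  rw [vertexFunctional_eq_sum_sides, vertexFunctional_eq_sum_sides, dominoFunctional, Fin.sum_univ_seven,
    show (Finset.univ : Finset Side) = {Side.E, Side.N, Side.W, Side.S} from by decide,
    Finset.sum_insert (by decide), Finset.sum_insert (by decide), Finset.sum_insert (by decide),
    Finset.sum_singleton, Finset.sum_insert (by decide), Finset.sum_insert (by decide),
    Finset.sum_insert (by decide), Finset.sum_singleton, ← side_E_eq_east_side_W, ← h]
  simp only [dominoSlot, leftCoeff, rightCoeff, slotIdx, Matrix.cons_val_zero, Matrix.cons_val_one,
    Matrix.head_cons, Matrix.cons_val_two, Matrix.tail_cons, Matrix.cons_val_three, Matrix.cons_val]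
  ring

/-- **Translates**: two one-plaquette relations, at `f` with `(γ₁, c_N, c_W, c_S)` and at `f⁺` with
`(c_E⁺, c_N⁺, γ₂, c_S⁺)`, make `c` (with `c_shared = γ₁ + γ₂`) a domino relation — the domino class
contains all sums of translates of the one-plaquette class. [cite: GlazmanManolescu2019, Lemma 2.1] -/
theorem exactDominoVertexRelation_of_plaquette {W : CWeights} {t : ℂ} {c : Fin 7 → ℂ} {γ₁ γ₂ : ℂ}
    (h : γ₁ + γ₂ = c 3) (hL : ExactPlaquetteVertexRelation W t (leftCoeff c γ₁))
    (hR : ExactPlaquetteVertexRelation W t (rightCoeff c γ₂)) : ExactDominoVertexRelation W t c := by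
  intro Dl a f hf hf' ha
  rw [dominoFunctional_eq_add W t c Dl a f h, hL Dl a f hf ha, hR Dl a (east f) hf' ha, add_zero]

/-! ### The plaquette row and the six two-plaquette rows -/

/-- **The plaquette row** of a coefficient vector `d` (slot order `(E, N, W, S)`) at the entry side `p`:
`Σ_x d_x · arcW(p → x) · t^{qTurn p x}` — the coefficient collected by a walk arriving fresh at the side `p`
of a plaquette together with its one-arc continuations inside it (`x = p`: it stops there, weight `1`).
(The group-one row of `PlaquetteWalkDegenerateIdentity`, named.) [cite: Glazman2015WeightedSAW, Lemma 3.1 (proof: the one-visit group, eq. (3.11))] -/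
def plaqRow (W : CWeights) (t : ℂ) (d : Fin 4 → ℂ) (p : Side) : ℂ :=
  ∑ x : Side, d (slotIdx x) * arcW W (arcKind p x) * t ^ qTurn p x

/-- The inner row entering `f⁺` through the shared side (its `W` side): `c_sh` plus the one-arc
continuations inside `f⁺`. [cite: Glazman2015WeightedSAW, Lemma 3.1 (proof, eq. (3.11))] -/
def innerR (W : CWeights) (t : ℂ) (c : Fin 7 → ℂ) : ℂ := plaqRow W t ![c 6, c 4, c 3, c 5] .W

/-- The inner row entering `f` through the shared side (its `E` side): `c_sh` plus the one-arc
continuations inside `f`. [cite: Glazman2015WeightedSAW, Lemma 3.1 (proof, eq. (3.11))] -/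
def innerL (W : CWeights) (t : ℂ) (c : Fin 7 → ℂ) : ℂ := plaqRow W t ![c 3, c 1, c 0, c 2] .E

/-- The DRESSED left vector: `(innerR, c_N, c_W, c_S)` — at `f`, the shared slot carries everything a walk
collects after crossing into `f⁺`. [cite: Glazman2015WeightedSAW, Lemma 3.1 (proof, eq. (3.11))] -/
def dressL (W : CWeights) (t : ℂ) (c : Fin 7 → ℂ) : Fin 4 → ℂ := ![innerR W t c, c 1, c 0, c 2]

/-- The DRESSED right vector: `(c_E⁺, c_N⁺, innerL, c_S⁺)`. [cite: Glazman2015WeightedSAW, Lemma 3.1 (proof, eq. (3.11))] -/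
def dressR (W : CWeights) (t : ℂ) (c : Fin 7 → ℂ) : Fin 4 → ℂ := ![c 6, c 4, innerL W t c, c 5]

/-- **The six two-plaquette rows vanish**: the rows of the dressed left vector at the three outer sides
`W, N, S` of `f` and of the dressed right vector at the three outer sides `E, N, S` of `f⁺` — the total
coefficient of a fresh arrival at an outer side of the domino with all its continuations of at most two
arcs inside the domino (a GM walk crosses the shared side at most once, so it alternates between the two
plaquettes at most once while inside). [cite: GlazmanManolescu2019, Lemma 2.1 (proof: grouping the walks by their behaviour outside a rhombus)] -/
def DominoRows (W : CWeights) (t : ℂ) (c : Fin 7 → ℂ) : Prop :=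
  plaqRow W t (dressL W t c) .W = 0 ∧ plaqRow W t (dressL W t c) .N = 0 ∧ plaqRow W t (dressL W t c) .S = 0 ∧
    plaqRow W t (dressR W t c) .E = 0 ∧ plaqRow W t (dressR W t c) .N = 0 ∧ plaqRow W t (dressR W t c) .S = 0

/-- The four values of a plaquette row, expanded (`x` runs over `W, E, S, N`). [cite: Glazman2015WeightedSAW, Lemma 3.1 (proof: the one-visit group, eq. (3.11))] -/
theorem plaqRow_eq (W : CWeights) (t : ℂ) (d : Fin 4 → ℂ) (p : Side) :
    plaqRow W t d p = d 2 * arcW W (arcKind p .W) * t ^ qTurn p .W + d 0 * arcW W (arcKind p .E) * t ^ qTurn p .E +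
      d 3 * arcW W (arcKind p .S) * t ^ qTurn p .S + d 1 * arcW W (arcKind p .N) * t ^ qTurn p .N := by
  rw [plaqRow, show (Finset.univ : Finset Side) = {Side.W, Side.E, Side.S, Side.N} from by decide,
    Finset.sum_insert (by decide), Finset.sum_insert (by decide), Finset.sum_insert (by decide),
    Finset.sum_singleton]
  simp only [slotIdx]
  ring

/-! ### The closed-form coefficient vector of the directed branch `u₁ = 0` -/

/-- ★ **The branch domino vector** `(v K₊, −u₂ t K₋, −2u₂ v t, K₋ K₊, −2u₂ v t, −u₂ t K₋, v K₊)`,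
`K± = u₂² − v² ± 1` (slot order `(f.W, f.N, f.S, shared, f⁺.N, f⁺.S, f⁺.E)`; palindromic = invariant under
the half-turn of the domino). [cite: Glazman2015WeightedSAW, Lemma 3.1 (proof: "solving this linear system")] -/
def branchDominoCoeff (u₂ v t : ℂ) : Fin 7 → ℂ :=
  ![v * (u₂ ^ 2 - v ^ 2 + 1), -(u₂ * t * (u₂ ^ 2 - v ^ 2 - 1)), -(2 * u₂ * v * t),
    (u₂ ^ 2 - v ^ 2 - 1) * (u₂ ^ 2 - v ^ 2 + 1), -(2 * u₂ * v * t), -(u₂ * t * (u₂ ^ 2 - v ^ 2 - 1)),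
    v * (u₂ ^ 2 - v ^ 2 + 1)]

section Rows

variable {W : CWeights} {t : ℂ}

/-- The six two-plaquette rows on `u₁ = 0`, written out: with `c = (c₀, …, c₆)`,
`R_W = c₀ + v c₃ + u₂t⁻¹ c₂ + v² c₆ + u₂ v t⁻¹ c₅`, `R_N = c₁ + v c₂ + u₂ t c₃ + u₂ v t c₆ + u₂² c₅`,
`R_S = c₂ + v c₁ + u₂ t c₀`, `R_E⁺ = c₆ + v c₃ + u₂ t⁻¹ c₄ + v² c₀ + u₂ v t⁻¹ c₁`,
`R_N⁺ = c₄ + v c₅ + u₂ t c₆`, `R_S⁺ = c₅ + v c₄ + u₂ t c₃ + u₂ v t c₀ + u₂² c₁`. [cite: Glazman2015WeightedSAW, Lemma 3.1 (proof: "solving this linear system")] -/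
theorem dominoRows_iff_of_u₁_eq_zero (ht : t ≠ 0) (h1 : W.u₁ = 0) (c : Fin 7 → ℂ) :
    DominoRows W t c ↔
      (c 0 + W.v * c 3 + W.u₂ * t⁻¹ * c 2 + W.v ^ 2 * c 6 + W.u₂ * W.v * t⁻¹ * c 5 = 0 ∧
        c 1 + W.v * c 2 + W.u₂ * t * c 3 + W.u₂ * W.v * t * c 6 + W.u₂ ^ 2 * c 5 = 0 ∧
        c 2 + W.v * c 1 + W.u₂ * t * c 0 = 0 ∧
        c 6 + W.v * c 3 + W.u₂ * t⁻¹ * c 4 + W.v ^ 2 * c 0 + W.u₂ * W.v * t⁻¹ * c 1 = 0 ∧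
        c 4 + W.v * c 5 + W.u₂ * t * c 6 = 0 ∧
        c 5 + W.v * c 4 + W.u₂ * t * c 3 + W.u₂ * W.v * t * c 0 + W.u₂ ^ 2 * c 1 = 0) := by
  have e : ∀ (d : Fin 4 → ℂ) (p : Side), plaqRow W t d p = d 2 * arcW W (arcKind p .W) * t ^ qTurn p .W +
      d 0 * arcW W (arcKind p .E) * t ^ qTurn p .E + d 3 * arcW W (arcKind p .S) * t ^ qTurn p .S +
      d 1 * arcW W (arcKind p .N) * t ^ qTurn p .N := plaqRow_eq W t
  have hti : t * t⁻¹ = 1 := mul_inv_cancel₀ ht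
  simp only [DominoRows, dressL, dressR, innerR, innerL, e, arcKind, arcW, qTurn, h1, Matrix.cons_val_zero,
    Matrix.cons_val_one, Matrix.head_cons, Matrix.cons_val_two, Matrix.tail_cons, Matrix.cons_val_three,
    zpow_zero, zpow_one, zpow_neg, mul_one, mul_zero, zero_mul, add_zero, zero_add, Int.reduceNeg]
  constructor
  · rintro ⟨hW, hN, hS, hE, hN', hS'⟩
    refine ⟨?_, ?_, ?_, ?_, ?_, ?_⟩
    · linear_combination hW
    · linear_combination hN + (-(W.u₂ ^ 2 * c 5)) * hti
    · linear_combination hS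
    · linear_combination hE
    · linear_combination hN'
    · linear_combination hS' + (-(W.u₂ ^ 2 * c 1)) * hti
  · rintro ⟨hW, hN, hS, hE, hN', hS'⟩
    refine ⟨?_, ?_, ?_, ?_, ?_, ?_⟩
    · linear_combination hW
    · linear_combination hN + (c 5 * W.u₂ ^ 2) * hti
    · linear_combination hS
    · linear_combination hE
    · linear_combination hN'
    · linear_combination hS' + (c 1 * W.u₂ ^ 2) * hti

/-- ★ **On `u₁ = 0` the branch domino vector kills all six two-plaquette rows** (every `u₂, v, w₁, w₂`,
every `t ≠ 0`). Three lines of algebra: `R_S` gives `c₂ = −u₂ t − α v` … see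
HOME/FINDING-Z2-DOMINO-CLASS.md. [cite: Glazman2015WeightedSAW, Lemma 3.1 (proof: "solving this linear system")] -/
theorem dominoRows_branchDominoCoeff (ht : t ≠ 0) (h1 : W.u₁ = 0) :
    DominoRows W t (branchDominoCoeff W.u₂ W.v t) := by
  rw [dominoRows_iff_of_u₁_eq_zero ht h1]
  have hti : t * t⁻¹ = 1 := mul_inv_cancel₀ ht
  simp only [branchDominoCoeff, Matrix.cons_val_zero, Matrix.cons_val_one, Matrix.head_cons,
    Matrix.cons_val_two, Matrix.tail_cons, Matrix.cons_val_three, Matrix.cons_val]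
  refine ⟨?_, ?_, ?_, ?_, ?_, ?_⟩
  · linear_combination (-(2 * W.u₂ ^ 2 * W.v) - W.u₂ ^ 2 * W.v * (W.u₂ ^ 2 - W.v ^ 2 - 1)) * hti
  · ring
  · ring
  · linear_combination (-(2 * W.u₂ ^ 2 * W.v) - W.u₂ ^ 2 * W.v * (W.u₂ ^ 2 - W.v ^ 2 - 1)) * hti
  · ring
  · ring

end Rows

/-- **The branch domino vector is nonzero** off the two quartic points `{v = 0, u₂² = 1}` and
`{u₂ = 0, v² = 1}` of the one-plaquette class (there it vanishes identically and the one-plaquette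
relations take over). [cite: Glazman2015WeightedSAW, Lemma 3.1 (proof: "solving this linear system")] -/
theorem branchDominoCoeff_ne_zero {u₂ v t : ℂ} (ht : t ≠ 0)
    (h : ¬((v = 0 ∧ u₂ ^ 2 = 1) ∨ (u₂ = 0 ∧ v ^ 2 = 1))) : branchDominoCoeff u₂ v t ≠ 0 := by
  intro hc
  have h0 := congrFun hc 0
  have h1 := congrFun hc 1
  have h2 := congrFun hc 2
  have h3 := congrFun hc 3
  simp only [branchDominoCoeff, Matrix.cons_val_zero, Matrix.cons_val_one, Matrix.head_cons,
    Matrix.cons_val_two, Matrix.tail_cons, Matrix.cons_val_three, Pi.zero_apply, neg_eq_zero,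
    mul_eq_zero, ht, or_false] at h0 h1 h2 h3
  apply h
  by_cases hv : v = 0
  · subst hv
    simp only [true_and, zero_pow two_ne_zero, sub_zero] at h3 ⊢
    left
    rcases h3 with h3 | h3
    · linear_combination h3
    · exfalso
      rcases h1 with hu | h1
      · rw [hu] at h3; norm_num at h3
      · have : (2 : ℂ) = 0 := by linear_combination h3 - h1
        norm_num at this
  · right
    have hK : u₂ ^ 2 - v ^ 2 + 1 = 0 := by
      rcases h0 with h0 | h0
      · exact absurd h0 hv
      · exact h0
    rcases h2 with (h2 | hu) | h2
    · norm_num at h2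
    · refine ⟨hu, ?_⟩
      rw [hu] at hK
      linear_combination -hK
    · exact absurd h2 hv



section MirrorRows

variable {W : CWeights} {t : ℂ}

/-- The six two-plaquette rows on `u₂ = 0`, written out: with `c = (c₀, …, c₆)`,
`R_W = c₀ + v c₃ + v² c₆ + u₁ v t c₄ + u₁ t c₁`, `R_N = c₁ + v c₂ + u₁ t⁻¹ c₀`,
`R_S = c₂ + v c₁ + u₁ t⁻¹ c₃ + u₁ v t⁻¹ c₆ + u₁² c₄`, `R_E⁺ = c₆ + v c₃ + v² c₀ + u₁ v t c₂ + u₁ t c₅`,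
`R_N⁺ = c₄ + v c₅ + u₁ t⁻¹ c₃ + u₁ v t⁻¹ c₀ + u₁² c₂`, `R_S⁺ = c₅ + v c₄ + u₁ t⁻¹ c₆`. [cite: Glazman2015WeightedSAW, Lemma 3.1 (proof: "solving this linear system")] -/
theorem dominoRows_iff_of_u₂_eq_zero (ht : t ≠ 0) (h2 : W.u₂ = 0) (c : Fin 7 → ℂ) :
    DominoRows W t c ↔
      (c 0 + W.v * c 3 + W.v ^ 2 * c 6 + W.u₁ * W.v * t * c 4 + W.u₁ * t * c 1 = 0 ∧
        c 1 + W.v * c 2 + W.u₁ * t⁻¹ * c 0 = 0 ∧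
        c 2 + W.v * c 1 + W.u₁ * t⁻¹ * c 3 + W.u₁ * W.v * t⁻¹ * c 6 + W.u₁ ^ 2 * c 4 = 0 ∧
        c 6 + W.v * c 3 + W.v ^ 2 * c 0 + W.u₁ * W.v * t * c 2 + W.u₁ * t * c 5 = 0 ∧
        c 4 + W.v * c 5 + W.u₁ * t⁻¹ * c 3 + W.u₁ * W.v * t⁻¹ * c 0 + W.u₁ ^ 2 * c 2 = 0 ∧
        c 5 + W.v * c 4 + W.u₁ * t⁻¹ * c 6 = 0) := by
  have e : ∀ (d : Fin 4 → ℂ) (p : Side), plaqRow W t d p = d 2 * arcW W (arcKind p .W) * t ^ qTurn p .W +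
      d 0 * arcW W (arcKind p .E) * t ^ qTurn p .E + d 3 * arcW W (arcKind p .S) * t ^ qTurn p .S +
      d 1 * arcW W (arcKind p .N) * t ^ qTurn p .N := plaqRow_eq W t
  have hti : t * t⁻¹ = 1 := mul_inv_cancel₀ ht
  simp only [DominoRows, dressL, dressR, innerR, innerL, e, arcKind, arcW, qTurn, h2, Matrix.cons_val_zero,
    Matrix.cons_val_one, Matrix.head_cons, Matrix.cons_val_two, Matrix.tail_cons, Matrix.cons_val_three,
    zpow_zero, zpow_one, zpow_neg, mul_one, mul_zero, zero_mul, add_zero, zero_add, Int.reduceNeg]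
  constructor
  · rintro ⟨hW, hN, hS, hE, hN', hS'⟩
    refine ⟨?_, ?_, ?_, ?_, ?_, ?_⟩
    · linear_combination hW
    · linear_combination hN
    · linear_combination hS + (-(W.u₁ ^ 2 * c 4)) * hti
    · linear_combination hE
    · linear_combination hN' + (-(W.u₁ ^ 2 * c 2)) * hti
    · linear_combination hS'
  · rintro ⟨hW, hN, hS, hE, hN', hS'⟩
    refine ⟨?_, ?_, ?_, ?_, ?_, ?_⟩
    · linear_combination hW
    · linear_combination hN
    · linear_combination hS + (c 4 * W.u₁ ^ 2) * hti
    · linear_combination hE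
    · linear_combination hN' + (c 2 * W.u₁ ^ 2) * hti
    · linear_combination hS'

/-- ★ **The mirror-branch domino vector** `(v t K₊, −2u₁ v, −u₁ K₋, t K₋ K₊, −u₁ K₋, −2u₁ v, v t K₊)`,
`K± = u₁² − v² ± 1` (slot order `(f.W, f.N, f.S, shared, f⁺.N, f⁺.S, f⁺.E)`; the image of `branchDominoCoeff`
under the reflection `k ↦ −k`, which exchanges the corner kinds and reverses the phase). [cite: Glazman2015WeightedSAW, Lemma 3.1 (proof: "solving this linear system")] -/
def branchDominoCoeffMirror (u₁ v t : ℂ) : Fin 7 → ℂ :=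
  ![v * t * (u₁ ^ 2 - v ^ 2 + 1), -(2 * u₁ * v), -(u₁ * (u₁ ^ 2 - v ^ 2 - 1)),
    t * (u₁ ^ 2 - v ^ 2 - 1) * (u₁ ^ 2 - v ^ 2 + 1), -(u₁ * (u₁ ^ 2 - v ^ 2 - 1)), -(2 * u₁ * v),
    v * t * (u₁ ^ 2 - v ^ 2 + 1)]

/-- ★ On `u₂ = 0` the mirror-branch vector kills all six two-plaquette rows (every `u₁, v, w₁, w₂`, every
`t ≠ 0`). [cite: Glazman2015WeightedSAW, Lemma 3.1 (proof: "solving this linear system")] -/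
theorem dominoRows_branchDominoCoeffMirror (ht : t ≠ 0) (h2 : W.u₂ = 0) :
    DominoRows W t (branchDominoCoeffMirror W.u₁ W.v t) := by
  rw [dominoRows_iff_of_u₂_eq_zero ht h2]
  have hti : t * t⁻¹ = 1 := mul_inv_cancel₀ ht
  simp only [branchDominoCoeffMirror, Matrix.cons_val_zero, Matrix.cons_val_one, Matrix.head_cons,
    Matrix.cons_val_two, Matrix.tail_cons, Matrix.cons_val_three, Matrix.cons_val]
  refine ⟨?_, ?_, ?_, ?_, ?_, ?_⟩
  · ring
  · linear_combination (W.u₁ * W.v * (W.u₁ ^ 2 - W.v ^ 2 + 1)) * hti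
  · linear_combination (W.u₁ * ((W.u₁ ^ 2 - W.v ^ 2 - 1) * (W.u₁ ^ 2 - W.v ^ 2 + 1) +
      W.v ^ 2 * (W.u₁ ^ 2 - W.v ^ 2 + 1))) * hti
  · ring
  · linear_combination (W.u₁ * ((W.u₁ ^ 2 - W.v ^ 2 - 1) * (W.u₁ ^ 2 - W.v ^ 2 + 1) +
      W.v ^ 2 * (W.u₁ ^ 2 - W.v ^ 2 + 1))) * hti
  · linear_combination (W.u₁ * W.v * (W.u₁ ^ 2 - W.v ^ 2 + 1)) * hti

/-- **The mirror-branch vector is nonzero** off the two quartic points `{v = 0, u₁² = 1}` and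
`{u₁ = 0, v² = 1}`. [cite: Glazman2015WeightedSAW, Lemma 3.1 (proof: "solving this linear system")] -/
theorem branchDominoCoeffMirror_ne_zero {u₁ v t : ℂ} (ht : t ≠ 0)
    (h : ¬((v = 0 ∧ u₁ ^ 2 = 1) ∨ (u₁ = 0 ∧ v ^ 2 = 1))) : branchDominoCoeffMirror u₁ v t ≠ 0 := by
  intro hc
  have h0 := congrFun hc 0
  have h1 := congrFun hc 1
  have h2 := congrFun hc 2
  have h3 := congrFun hc 3
  simp only [branchDominoCoeffMirror, Matrix.cons_val_zero, Matrix.cons_val_one, Matrix.head_cons,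
    Matrix.cons_val_two, Matrix.tail_cons, Matrix.cons_val_three, Pi.zero_apply, neg_eq_zero,
    mul_eq_zero, ht, or_false, false_or] at h0 h1 h2 h3
  apply h
  by_cases hv : v = 0
  · subst hv
    simp only [true_and, zero_pow two_ne_zero, sub_zero] at h2 h3 ⊢
    left
    rcases h3 with h3 | h3
    · linear_combination h3
    · exfalso
      rcases h2 with hu | h2
      · rw [hu] at h3; norm_num at h3
      · have : (2 : ℂ) = 0 := by linear_combination h3 - h2
        norm_num at this
  · right
    have hK : u₁ ^ 2 - v ^ 2 + 1 = 0 := by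
      rcases h0 with h0 | h0
      · exact absurd h0 hv
      · exact h0
    rcases h1 with (h1 | hu) | h1
    · norm_num at h1
    · refine ⟨hu, ?_⟩
      rw [hu] at hK
      linear_combination -hK
    · exact absurd h1 hv

end MirrorRows

/-! ## Necessity of the six rows (every weight system) -/

section Necessity

variable {W : CWeights} {t : ℂ} {c : Fin 7 → ℂ}


/-- The bare domino `[(0,0), (1,0)]`. [cite: GlazmanManolescu2019, §1 (faces (k, j))] -/
def domD : List Face := [(0, 0), (1, 0)]

/-- The relation on the bare domino, split into the two one-plaquette functionals (left vector carries the
whole shared coefficient). [cite: DuminilCopinSmirnov2012, Lemma 1 (linear in the coefficients)] -/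
private theorem split_domD (hrel : ExactDominoVertexRelation W t c) {a : MidEdge}
    (ha : IsBoundaryRoot domD a) :
    vertexFunctional W t (leftCoeff c (c 3)) domD a (0, 0) +
      vertexFunctional W t (rightCoeff c 0) domD a (1, 0) = 0 := by
  have h := hrel domD a (0, 0) (by simp [domD]) (by simp [domD, east]) ha
  rwa [dominoFunctional_eq_add W t c domD a (0, 0) (show c 3 + 0 = c 3 by ring)] at h

/-! #### The six cleared rows (general weights) -/

/-- The row at the west side of `f`, cleared by `t²`. [cite: Glazman2015WeightedSAW, Lemma 3.1 (proof: "solving this linear system")] -/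
private theorem rowLW_mul (ht : t ≠ 0) : plaqRow W t (dressL W t c) .W * t ^ 2 =
    c 0 * t ^ 2 + c 2 * W.u₂ * t + c 1 * W.u₁ * t ^ 3 + c 3 * W.v * t ^ 2 + c 6 * W.v ^ 2 * t ^ 2 +
      c 5 * W.u₂ * W.v * t + c 4 * W.u₁ * W.v * t ^ 3 := by
  have hti : t * t⁻¹ = 1 := mul_inv_cancel₀ ht
  rw [plaqRow_eq, dressL, innerR, plaqRow_eq]
  simp only [arcKind, arcW, qTurn, Matrix.cons_val_zero, Matrix.cons_val_one, Matrix.head_cons,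
    Matrix.cons_val_two, Matrix.tail_cons, Matrix.cons_val_three, zpow_zero, zpow_one, zpow_neg, mul_one,
    Int.reduceNeg]
  linear_combination (c 2 * W.u₂ * t + c 5 * W.u₂ * W.v * t) * hti

/-- The row at the north side of `f`, cleared by `t²`. [cite: Glazman2015WeightedSAW, Lemma 3.1 (proof: "solving this linear system")] -/
private theorem rowLN_mul (ht : t ≠ 0) : plaqRow W t (dressL W t c) .N * t ^ 2 =
    c 1 * t ^ 2 + c 0 * W.u₁ * t + c 2 * W.v * t ^ 2 + c 3 * W.u₂ * t ^ 3 + c 6 * W.u₂ * W.v * t ^ 3 +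
      c 5 * W.u₂ ^ 2 * t ^ 2 + c 4 * W.u₁ * W.u₂ * t ^ 4 := by
  have hti : t * t⁻¹ = 1 := mul_inv_cancel₀ ht
  rw [plaqRow_eq, dressL, innerR, plaqRow_eq]
  simp only [arcKind, arcW, qTurn, Matrix.cons_val_zero, Matrix.cons_val_one, Matrix.head_cons,
    Matrix.cons_val_two, Matrix.tail_cons, Matrix.cons_val_three, zpow_zero, zpow_one, zpow_neg, mul_one,
    Int.reduceNeg]
  linear_combination (c 0 * W.u₁ * t + c 5 * W.u₂ ^ 2 * t ^ 2) * hti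

/-- The row at the south side of `f`, cleared by `t²`. [cite: Glazman2015WeightedSAW, Lemma 3.1 (proof: "solving this linear system")] -/
private theorem rowLS_mul (ht : t ≠ 0) : plaqRow W t (dressL W t c) .S * t ^ 2 =
    c 2 * t ^ 2 + c 0 * W.u₂ * t ^ 3 + c 1 * W.v * t ^ 2 + c 3 * W.u₁ * t + c 6 * W.u₁ * W.v * t +
      c 5 * W.u₁ * W.u₂ + c 4 * W.u₁ ^ 2 * t ^ 2 := by
  have hti : t * t⁻¹ = 1 := mul_inv_cancel₀ ht
  rw [plaqRow_eq, dressL, innerR, plaqRow_eq]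
  simp only [arcKind, arcW, qTurn, Matrix.cons_val_zero, Matrix.cons_val_one, Matrix.head_cons,
    Matrix.cons_val_two, Matrix.tail_cons, Matrix.cons_val_three, zpow_zero, zpow_one, zpow_neg, mul_one,
    Int.reduceNeg]
  linear_combination (c 3 * W.u₁ * t + c 6 * W.u₁ * W.v * t + c 5 * W.u₁ * W.u₂ + c 5 * W.u₁ * W.u₂ * t * t⁻¹ +
    c 4 * W.u₁ ^ 2 * t ^ 2) * hti

/-- The row at the east side of `f⁺`, cleared by `t²`. [cite: Glazman2015WeightedSAW, Lemma 3.1 (proof: "solving this linear system")] -/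
private theorem rowRE_mul (ht : t ≠ 0) : plaqRow W t (dressR W t c) .E * t ^ 2 =
    c 6 * t ^ 2 + c 4 * W.u₂ * t + c 5 * W.u₁ * t ^ 3 + c 3 * W.v * t ^ 2 + c 0 * W.v ^ 2 * t ^ 2 +
      c 1 * W.u₂ * W.v * t + c 2 * W.u₁ * W.v * t ^ 3 := by
  have hti : t * t⁻¹ = 1 := mul_inv_cancel₀ ht
  rw [plaqRow_eq, dressR, innerL, plaqRow_eq]
  simp only [arcKind, arcW, qTurn, Matrix.cons_val_zero, Matrix.cons_val_one, Matrix.head_cons,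
    Matrix.cons_val_two, Matrix.tail_cons, Matrix.cons_val_three, zpow_zero, zpow_one, zpow_neg, mul_one,
    Int.reduceNeg]
  linear_combination (c 4 * W.u₂ * t + c 1 * W.u₂ * W.v * t) * hti

/-- The row at the north side of `f⁺`, cleared by `t²`. [cite: Glazman2015WeightedSAW, Lemma 3.1 (proof: "solving this linear system")] -/
private theorem rowRN_mul (ht : t ≠ 0) : plaqRow W t (dressR W t c) .N * t ^ 2 =
    c 4 * t ^ 2 + c 6 * W.u₂ * t ^ 3 + c 5 * W.v * t ^ 2 + c 3 * W.u₁ * t + c 0 * W.u₁ * W.v * t +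
      c 1 * W.u₁ * W.u₂ + c 2 * W.u₁ ^ 2 * t ^ 2 := by
  have hti : t * t⁻¹ = 1 := mul_inv_cancel₀ ht
  rw [plaqRow_eq, dressR, innerL, plaqRow_eq]
  simp only [arcKind, arcW, qTurn, Matrix.cons_val_zero, Matrix.cons_val_one, Matrix.head_cons,
    Matrix.cons_val_two, Matrix.tail_cons, Matrix.cons_val_three, zpow_zero, zpow_one, zpow_neg, mul_one,
    Int.reduceNeg]
  linear_combination (c 3 * W.u₁ * t + c 0 * W.u₁ * W.v * t + c 1 * W.u₁ * W.u₂ + c 1 * W.u₁ * W.u₂ * t * t⁻¹ +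
    c 2 * W.u₁ ^ 2 * t ^ 2) * hti

/-- The row at the south side of `f⁺`, cleared by `t²`. [cite: Glazman2015WeightedSAW, Lemma 3.1 (proof: "solving this linear system")] -/
private theorem rowRS_mul (ht : t ≠ 0) : plaqRow W t (dressR W t c) .S * t ^ 2 =
    c 5 * t ^ 2 + c 6 * W.u₁ * t + c 4 * W.v * t ^ 2 + c 3 * W.u₂ * t ^ 3 + c 0 * W.u₂ * W.v * t ^ 3 +
      c 1 * W.u₂ ^ 2 * t ^ 2 + c 2 * W.u₁ * W.u₂ * t ^ 4 := by
  have hti : t * t⁻¹ = 1 := mul_inv_cancel₀ ht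
  rw [plaqRow_eq, dressR, innerL, plaqRow_eq]
  simp only [arcKind, arcW, qTurn, Matrix.cons_val_zero, Matrix.cons_val_one, Matrix.head_cons,
    Matrix.cons_val_two, Matrix.tail_cons, Matrix.cons_val_three, zpow_zero, zpow_one, zpow_neg, mul_one,
    Int.reduceNeg]
  linear_combination (c 6 * W.u₁ * t + c 1 * W.u₂ ^ 2 * t ^ 2) * hti

/-! #### The six instances on the bare domino (kernel enumeration by `decide`) -/

/-- Instance at the west side of `f`: 4 + 4 walks. [cite: GlazmanManolescu2019, Lemma 2.1 (proof: the walks at one rhombus)] -/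
private theorem instLW (hrel : ExactDominoVertexRelation W t c) (ht : t ≠ 0) :
    plaqRow W t (dressL W t c) .W = 0 := by
  have hT1 : termsN domD (Face.side (0, 0) .W) (0, 0) (depth domD) 2 =
      [⟨2, 0, 0, 0, 0, 0, 2⟩, ⟨3, 0, 1, 0, 0, 0, 1⟩, ⟨1, 1, 0, 0, 0, 0, 3⟩, ⟨0, 0, 0, 1, 0, 0, 2⟩] := by
    decide
  have hT2 : termsN domD (Face.side (0, 0) .W) (1, 0) (depth domD) 2 =
      [⟨2, 0, 0, 1, 0, 0, 2⟩, ⟨0, 0, 0, 2, 0, 0, 2⟩, ⟨3, 0, 1, 1, 0, 0, 1⟩, ⟨1, 1, 0, 1, 0, 0, 3⟩] := by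
    decide
  have h1 := vertexFunctional_mul_pow_eq_rowSumN W ht (leftCoeff c (c 3)) domD (Face.side (0, 0) .W) (0, 0) 2
    (by decide)
  have h2 := vertexFunctional_mul_pow_eq_rowSumN W ht (rightCoeff c 0) domD (Face.side (0, 0) .W) (1, 0) 2
    (by decide)
  have h := split_domD hrel (a := Face.side (0, 0) .W) (by decide)
  have h' : vertexFunctional W t (leftCoeff c (c 3)) domD (Face.side (0, 0) .W) (0, 0) * t ^ 2 +
      vertexFunctional W t (rightCoeff c 0) domD (Face.side (0, 0) .W) (1, 0) * t ^ 2 = 0 := by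
    rw [← add_mul, h, zero_mul]
  rw [h1, h2, hT1, hT2] at h'
  simp only [rowSumN, List.map_cons, List.map_nil, List.sum_cons, List.sum_nil, CWeights.mono, pow_zero,
    pow_one, mul_one, one_mul, leftCoeff, rightCoeff, Matrix.cons_val_zero, Matrix.cons_val_one,
    Matrix.head_cons, Matrix.cons_val_two, Matrix.tail_cons, Matrix.cons_val_three, zero_mul,
    add_zero] at h'
  have key : plaqRow W t (dressL W t c) .W * t ^ 2 = 0 := by
    rw [rowLW_mul ht]
    linear_combination h'
  exact (mul_eq_zero.1 key).resolve_right (pow_ne_zero 2 ht)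

/-- Instance at the north side of `f`. [cite: GlazmanManolescu2019, Lemma 2.1 (proof: the walks at one rhombus)] -/
private theorem instLN (hrel : ExactDominoVertexRelation W t c) (ht : t ≠ 0) :
    plaqRow W t (dressL W t c) .N = 0 := by
  have hT1 : termsN domD (Face.side (0, 0) .N) (0, 0) (depth domD) 2 =
      [⟨1, 0, 0, 0, 0, 0, 2⟩, ⟨2, 1, 0, 0, 0, 0, 1⟩, ⟨3, 0, 0, 1, 0, 0, 2⟩, ⟨0, 0, 1, 0, 0, 0, 3⟩] := by
    decide
  have hT2 : termsN domD (Face.side (0, 0) .N) (1, 0) (depth domD) 2 =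
      [⟨2, 0, 1, 0, 0, 0, 3⟩, ⟨0, 0, 1, 1, 0, 0, 3⟩, ⟨3, 0, 2, 0, 0, 0, 2⟩, ⟨1, 1, 1, 0, 0, 0, 4⟩] := by
    decide
  have h1 := vertexFunctional_mul_pow_eq_rowSumN W ht (leftCoeff c (c 3)) domD (Face.side (0, 0) .N) (0, 0) 2
    (by decide)
  have h2 := vertexFunctional_mul_pow_eq_rowSumN W ht (rightCoeff c 0) domD (Face.side (0, 0) .N) (1, 0) 2
    (by decide)
  have h := split_domD hrel (a := Face.side (0, 0) .N) (by decide)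
  have h' : vertexFunctional W t (leftCoeff c (c 3)) domD (Face.side (0, 0) .N) (0, 0) * t ^ 2 +
      vertexFunctional W t (rightCoeff c 0) domD (Face.side (0, 0) .N) (1, 0) * t ^ 2 = 0 := by
    rw [← add_mul, h, zero_mul]
  rw [h1, h2, hT1, hT2] at h'
  simp only [rowSumN, List.map_cons, List.map_nil, List.sum_cons, List.sum_nil, CWeights.mono, pow_zero,
    pow_one, mul_one, one_mul, leftCoeff, rightCoeff, Matrix.cons_val_zero, Matrix.cons_val_one,
    Matrix.head_cons, Matrix.cons_val_two, Matrix.tail_cons, Matrix.cons_val_three, zero_mul,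
    add_zero] at h'
  have key : plaqRow W t (dressL W t c) .N * t ^ 2 = 0 := by
    rw [rowLN_mul ht]
    linear_combination h'
  exact (mul_eq_zero.1 key).resolve_right (pow_ne_zero 2 ht)

/-- Instance at the south side of `f`. [cite: GlazmanManolescu2019, Lemma 2.1 (proof: the walks at one rhombus)] -/
private theorem instLS (hrel : ExactDominoVertexRelation W t c) (ht : t ≠ 0) :
    plaqRow W t (dressL W t c) .S = 0 := by
  have hT1 : termsN domD (Face.side (0, 0) .S) (0, 0) (depth domD) 2 =
      [⟨3, 0, 0, 0, 0, 0, 2⟩, ⟨2, 0, 1, 0, 0, 0, 3⟩, ⟨1, 0, 0, 1, 0, 0, 2⟩, ⟨0, 1, 0, 0, 0, 0, 1⟩] := by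
    decide
  have hT2 : termsN domD (Face.side (0, 0) .S) (1, 0) (depth domD) 2 =
      [⟨2, 1, 0, 0, 0, 0, 1⟩, ⟨0, 1, 0, 1, 0, 0, 1⟩, ⟨3, 1, 1, 0, 0, 0, 0⟩, ⟨1, 2, 0, 0, 0, 0, 2⟩] := by
    decide
  have h1 := vertexFunctional_mul_pow_eq_rowSumN W ht (leftCoeff c (c 3)) domD (Face.side (0, 0) .S) (0, 0) 2
    (by decide)
  have h2 := vertexFunctional_mul_pow_eq_rowSumN W ht (rightCoeff c 0) domD (Face.side (0, 0) .S) (1, 0) 2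
    (by decide)
  have h := split_domD hrel (a := Face.side (0, 0) .S) (by decide)
  have h' : vertexFunctional W t (leftCoeff c (c 3)) domD (Face.side (0, 0) .S) (0, 0) * t ^ 2 +
      vertexFunctional W t (rightCoeff c 0) domD (Face.side (0, 0) .S) (1, 0) * t ^ 2 = 0 := by
    rw [← add_mul, h, zero_mul]
  rw [h1, h2, hT1, hT2] at h'
  simp only [rowSumN, List.map_cons, List.map_nil, List.sum_cons, List.sum_nil, CWeights.mono, pow_zero,
    pow_one, mul_one, one_mul, leftCoeff, rightCoeff, Matrix.cons_val_zero, Matrix.cons_val_one,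
    Matrix.head_cons, Matrix.cons_val_two, Matrix.tail_cons, Matrix.cons_val_three, zero_mul,
    add_zero] at h'
  have key : plaqRow W t (dressL W t c) .S * t ^ 2 = 0 := by
    rw [rowLS_mul ht]
    linear_combination h'
  exact (mul_eq_zero.1 key).resolve_right (pow_ne_zero 2 ht)

/-- Instance at the east side of `f⁺`. [cite: GlazmanManolescu2019, Lemma 2.1 (proof: the walks at one rhombus)] -/
private theorem instRE (hrel : ExactDominoVertexRelation W t c) (ht : t ≠ 0) :
    plaqRow W t (dressR W t c) .E = 0 := by
  have hT1 : termsN domD (Face.side (1, 0) .E) (0, 0) (depth domD) 2 =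
      [⟨0, 0, 0, 1, 0, 0, 2⟩, ⟨2, 0, 0, 2, 0, 0, 2⟩, ⟨3, 1, 0, 1, 0, 0, 3⟩, ⟨1, 0, 1, 1, 0, 0, 1⟩] := by
    decide
  have hT2 : termsN domD (Face.side (1, 0) .E) (1, 0) (depth domD) 2 =
      [⟨0, 0, 0, 0, 0, 0, 2⟩, ⟨2, 0, 0, 1, 0, 0, 2⟩, ⟨3, 1, 0, 0, 0, 0, 3⟩, ⟨1, 0, 1, 0, 0, 0, 1⟩] := by
    decide
  have h1 := vertexFunctional_mul_pow_eq_rowSumN W ht (leftCoeff c (c 3)) domD (Face.side (1, 0) .E) (0, 0) 2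
    (by decide)
  have h2 := vertexFunctional_mul_pow_eq_rowSumN W ht (rightCoeff c 0) domD (Face.side (1, 0) .E) (1, 0) 2
    (by decide)
  have h := split_domD hrel (a := Face.side (1, 0) .E) (by decide)
  have h' : vertexFunctional W t (leftCoeff c (c 3)) domD (Face.side (1, 0) .E) (0, 0) * t ^ 2 +
      vertexFunctional W t (rightCoeff c 0) domD (Face.side (1, 0) .E) (1, 0) * t ^ 2 = 0 := by
    rw [← add_mul, h, zero_mul]
  rw [h1, h2, hT1, hT2] at h'
  simp only [rowSumN, List.map_cons, List.map_nil, List.sum_cons, List.sum_nil, CWeights.mono, pow_zero,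
    pow_one, mul_one, one_mul, leftCoeff, rightCoeff, Matrix.cons_val_zero, Matrix.cons_val_one,
    Matrix.head_cons, Matrix.cons_val_two, Matrix.tail_cons, Matrix.cons_val_three, zero_mul,
    add_zero] at h'
  have key : plaqRow W t (dressR W t c) .E * t ^ 2 = 0 := by
    rw [rowRE_mul ht]
    linear_combination h'
  exact (mul_eq_zero.1 key).resolve_right (pow_ne_zero 2 ht)

/-- Instance at the north side of `f⁺`. [cite: GlazmanManolescu2019, Lemma 2.1 (proof: the walks at one rhombus)] -/
private theorem instRN (hrel : ExactDominoVertexRelation W t c) (ht : t ≠ 0) :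
    plaqRow W t (dressR W t c) .N = 0 := by
  have hT1 : termsN domD (Face.side (1, 0) .N) (0, 0) (depth domD) 2 =
      [⟨0, 1, 0, 0, 0, 0, 1⟩, ⟨2, 1, 0, 1, 0, 0, 1⟩, ⟨3, 2, 0, 0, 0, 0, 2⟩, ⟨1, 1, 1, 0, 0, 0, 0⟩] := by
    decide
  have hT2 : termsN domD (Face.side (1, 0) .N) (1, 0) (depth domD) 2 =
      [⟨1, 0, 0, 0, 0, 0, 2⟩, ⟨2, 1, 0, 0, 0, 0, 1⟩, ⟨0, 0, 1, 0, 0, 0, 3⟩, ⟨3, 0, 0, 1, 0, 0, 2⟩] := by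
    decide
  have h1 := vertexFunctional_mul_pow_eq_rowSumN W ht (leftCoeff c (c 3)) domD (Face.side (1, 0) .N) (0, 0) 2
    (by decide)
  have h2 := vertexFunctional_mul_pow_eq_rowSumN W ht (rightCoeff c 0) domD (Face.side (1, 0) .N) (1, 0) 2
    (by decide)
  have h := split_domD hrel (a := Face.side (1, 0) .N) (by decide)
  have h' : vertexFunctional W t (leftCoeff c (c 3)) domD (Face.side (1, 0) .N) (0, 0) * t ^ 2 +
      vertexFunctional W t (rightCoeff c 0) domD (Face.side (1, 0) .N) (1, 0) * t ^ 2 = 0 := by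
    rw [← add_mul, h, zero_mul]
  rw [h1, h2, hT1, hT2] at h'
  simp only [rowSumN, List.map_cons, List.map_nil, List.sum_cons, List.sum_nil, CWeights.mono, pow_zero,
    pow_one, mul_one, one_mul, leftCoeff, rightCoeff, Matrix.cons_val_zero, Matrix.cons_val_one,
    Matrix.head_cons, Matrix.cons_val_two, Matrix.tail_cons, Matrix.cons_val_three, zero_mul,
    add_zero] at h'
  have key : plaqRow W t (dressR W t c) .N * t ^ 2 = 0 := by
    rw [rowRN_mul ht]
    linear_combination h'
  exact (mul_eq_zero.1 key).resolve_right (pow_ne_zero 2 ht)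

/-- Instance at the south side of `f⁺`. [cite: GlazmanManolescu2019, Lemma 2.1 (proof: the walks at one rhombus)] -/
private theorem instRS (hrel : ExactDominoVertexRelation W t c) (ht : t ≠ 0) :
    plaqRow W t (dressR W t c) .S = 0 := by
  have hT1 : termsN domD (Face.side (1, 0) .S) (0, 0) (depth domD) 2 =
      [⟨0, 0, 1, 0, 0, 0, 3⟩, ⟨2, 0, 1, 1, 0, 0, 3⟩, ⟨3, 1, 1, 0, 0, 0, 4⟩, ⟨1, 0, 2, 0, 0, 0, 2⟩] := by
    decide
  have hT2 : termsN domD (Face.side (1, 0) .S) (1, 0) (depth domD) 2 =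
      [⟨3, 0, 0, 0, 0, 0, 2⟩, ⟨2, 0, 1, 0, 0, 0, 3⟩, ⟨0, 1, 0, 0, 0, 0, 1⟩, ⟨1, 0, 0, 1, 0, 0, 2⟩] := by
    decide
  have h1 := vertexFunctional_mul_pow_eq_rowSumN W ht (leftCoeff c (c 3)) domD (Face.side (1, 0) .S) (0, 0) 2
    (by decide)
  have h2 := vertexFunctional_mul_pow_eq_rowSumN W ht (rightCoeff c 0) domD (Face.side (1, 0) .S) (1, 0) 2
    (by decide)
  have h := split_domD hrel (a := Face.side (1, 0) .S) (by decide)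
  have h' : vertexFunctional W t (leftCoeff c (c 3)) domD (Face.side (1, 0) .S) (0, 0) * t ^ 2 +
      vertexFunctional W t (rightCoeff c 0) domD (Face.side (1, 0) .S) (1, 0) * t ^ 2 = 0 := by
    rw [← add_mul, h, zero_mul]
  rw [h1, h2, hT1, hT2] at h'
  simp only [rowSumN, List.map_cons, List.map_nil, List.sum_cons, List.sum_nil, CWeights.mono, pow_zero,
    pow_one, mul_one, one_mul, leftCoeff, rightCoeff, Matrix.cons_val_zero, Matrix.cons_val_one,
    Matrix.head_cons, Matrix.cons_val_two, Matrix.tail_cons, Matrix.cons_val_three, zero_mul,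
    add_zero] at h'
  have key : plaqRow W t (dressR W t c) .S * t ^ 2 = 0 := by
    rw [rowRS_mul ht]
    linear_combination h'
  exact (mul_eq_zero.1 key).resolve_right (pow_ne_zero 2 ht)

/-- ★ **The six two-plaquette rows are NECESSARY**, for every weight system and every phase `t ≠ 0`: an
exact domino relation, tested on the bare domino `[(0,0), (1,0)]` from its six boundary roots, forces
`DominoRows W t c`. [cite: Glazman2015WeightedSAW, Lemma 3.1 (proof: necessity by the one-visit group, eq. (3.11))] -/
theorem dominoRows_of_exactDominoVertexRelation (hrel : ExactDominoVertexRelation W t c) (ht : t ≠ 0) :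
    DominoRows W t c :=
  ⟨instLW hrel ht, instLN hrel ht, instLS hrel ht, instRE hrel ht, instRN hrel ht, instRS hrel ht⟩

/-! ### Off the quartic: the branch's domino class is ONE line -/

/-- ★★ **The row space on the branch `u₁ = 0`, solved off the quartic**: if
`(1+v−u₂)(1+v+u₂)(1−v−u₂)(1−v+u₂) ≠ 0`, the six rows say exactly that `c` is symmetric under the half-turn
of the domino (`c₆ = c₀, c₅ = c₁, c₄ = c₂`) and satisfies the three symmetric equations
`c₂ = −v c₁ − u₂ t c₀`, `v c₃ = K₋ c₀`, `K₊ c₁ + u₂ t c₃ = 0` (`K± = u₂² − v² ± 1`) — a system of rank six,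
whose solution line is `ℂ · branchDominoCoeff u₂ v t` (`dominoRows_proportional_of_u₁_eq_zero`). The
antisymmetric part dies exactly because its `2 × 2` determinant is the quartic.
[cite: Glazman2015WeightedSAW, Lemma 3.1 (proof: "solving this linear system")] -/
theorem dominoRows_iff_sym_of_u₁_eq_zero (ht : t ≠ 0) (h1 : W.u₁ = 0)
    (hq : (1 + W.v - W.u₂) * (1 + W.v + W.u₂) * (1 - W.v - W.u₂) * (1 - W.v + W.u₂) ≠ 0) :
    DominoRows W t c ↔
      (c 6 = c 0 ∧ c 5 = c 1 ∧ c 4 = c 2 ∧ c 2 = -(W.v * c 1) - W.u₂ * t * c 0 ∧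
        W.v * c 3 = (W.u₂ ^ 2 - W.v ^ 2 - 1) * c 0 ∧ (W.u₂ ^ 2 - W.v ^ 2 + 1) * c 1 + W.u₂ * t * c 3 = 0) := by
  have hti : t * t⁻¹ = 1 := mul_inv_cancel₀ ht
  rw [dominoRows_iff_of_u₁_eq_zero ht h1]
  constructor
  · rintro ⟨hW, hN, hS, hE, hN', hS'⟩
    -- antisymmetric part `aᵢ = cᵢ − c₆₋ᵢ`
    have e2 : (c 2 - c 4) + W.v * (c 1 - c 5) + W.u₂ * t * (c 0 - c 6) = 0 := by
      linear_combination hS - hN'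
    have eW : (c 0 - c 6) * (1 - W.u₂ ^ 2 - W.v ^ 2) - 2 * W.u₂ * W.v * t⁻¹ * (c 1 - c 5) = 0 := by
      linear_combination (hW - hE) - W.u₂ * t⁻¹ * (hS - hN') + W.u₂ ^ 2 * (c 0 - c 6) * hti
    have eN : (c 1 - c 5) * (1 - W.u₂ ^ 2 - W.v ^ 2) - 2 * W.u₂ * W.v * t * (c 0 - c 6) = 0 := by
      linear_combination (hN - hS') - W.v * (hS - hN')
    have hQ0 : (c 0 - c 6) * ((1 + W.v - W.u₂) * (1 + W.v + W.u₂) * (1 - W.v - W.u₂) * (1 - W.v + W.u₂)) =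
        0 := by
      linear_combination (1 - W.u₂ ^ 2 - W.v ^ 2) * eW + (2 * W.u₂ * W.v * t⁻¹) * eN +
        4 * W.u₂ ^ 2 * W.v ^ 2 * (c 0 - c 6) * hti
    have a0 : c 0 - c 6 = 0 := (mul_eq_zero.1 hQ0).resolve_right hq
    have a1 : c 1 - c 5 = 0 := by
      by_cases hD : 1 - W.u₂ ^ 2 - W.v ^ 2 = 0
      · have huv : W.u₂ * W.v ≠ 0 := by
          intro h0
          apply hq
          have : (1 + W.v - W.u₂) * (1 + W.v + W.u₂) * (1 - W.v - W.u₂) * (1 - W.v + W.u₂) =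
              (1 - W.u₂ ^ 2 - W.v ^ 2) ^ 2 - 4 * (W.u₂ * W.v) ^ 2 := by ring
          rw [this, hD, h0]; ring
        have h2 : (2 * (W.u₂ * W.v) * t⁻¹) * (c 1 - c 5) = 0 := by
          linear_combination -eW + (1 - W.u₂ ^ 2 - W.v ^ 2) * a0
        rcases mul_eq_zero.1 h2 with h3 | h3
        · exfalso
          rcases mul_eq_zero.1 h3 with h4 | h4
          · rcases mul_eq_zero.1 h4 with h5 | h5
            · norm_num at h5
            · exact huv h5
          · exact inv_ne_zero ht h4
        · exact h3
      · have h2 : (c 1 - c 5) * (1 - W.u₂ ^ 2 - W.v ^ 2) = 0 := by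
          linear_combination eN + 2 * W.u₂ * W.v * t * a0
        exact (mul_eq_zero.1 h2).resolve_right hD
    have a2 : c 2 - c 4 = 0 := by linear_combination e2 - W.v * a1 - W.u₂ * t * a0
    refine ⟨by linear_combination -a0, by linear_combination -a1, by linear_combination -a2,
      by linear_combination hS, ?_, ?_⟩
    · linear_combination hW - W.u₂ * t⁻¹ * hS + W.v ^ 2 * a0 + W.u₂ * W.v * t⁻¹ * a1 +
        W.u₂ ^ 2 * c 0 * hti
    · linear_combination hN - W.v * hS + W.u₂ * W.v * t * a0 + W.u₂ ^ 2 * a1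
  · rintro ⟨h6, h5, h4, h2, h3, hK⟩
    refine ⟨?_, ?_, ?_, ?_, ?_, ?_⟩
    · linear_combination h3 + W.u₂ * t⁻¹ * h2 + W.v ^ 2 * h6 + W.u₂ * W.v * t⁻¹ * h5 -
        W.u₂ ^ 2 * c 0 * hti
    · linear_combination hK + W.v * h2 + W.u₂ * W.v * t * h6 + W.u₂ ^ 2 * h5
    · linear_combination h2
    · linear_combination h6 + h3 + W.u₂ * t⁻¹ * (h4 + h2) - W.u₂ ^ 2 * c 0 * hti
    · linear_combination h4 + h2 + W.v * h5 + W.u₂ * t * h6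
    · linear_combination h5 + W.v * h4 + hK + W.v * h2
/-- ★★ **Proportionality**: on `u₁ = 0` off the quartic every solution of the rows — hence every exact
domino relation — satisfies `cᵢ · (v K₊) = c₀ · (branchDominoCoeff u₂ v t)ᵢ` for all seven slots, i.e.
`c` is the multiple `c₀ / (v K₊)` of the closed-form vector wherever `v K₊ ≠ 0` (and `c₀ = 0` where
`v K₊ = 0`): the domino technique class of the branch is the single line `ℂ · branchDominoCoeff u₂ v t`.
[cite: Glazman2015WeightedSAW, Lemma 3.1 (proof: "solving this linear system")] -/
theorem dominoRows_proportional_of_u₁_eq_zero (ht : t ≠ 0) (h1 : W.u₁ = 0)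
    (hq : (1 + W.v - W.u₂) * (1 + W.v + W.u₂) * (1 - W.v - W.u₂) * (1 - W.v + W.u₂) ≠ 0)
    (hrows : DominoRows W t c) (i : Fin 7) :
    c i * (W.v * (W.u₂ ^ 2 - W.v ^ 2 + 1)) = c 0 * branchDominoCoeff W.u₂ W.v t i := by
  obtain ⟨h6, h5, h4, h2, h3, hK⟩ := (dominoRows_iff_sym_of_u₁_eq_zero ht h1 hq).1 hrows
  fin_cases i <;>
    simp only [branchDominoCoeff, Matrix.cons_val_zero, Matrix.cons_val_one, Matrix.head_cons,
      Matrix.cons_val_two, Matrix.tail_cons, Matrix.cons_val_three, Matrix.cons_val, Fin.zero_eta, Fin.mk_one,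
      Fin.reduceFinMk]
  · linear_combination W.v * hK - W.u₂ * t * h3
  · linear_combination (W.v * (W.u₂ ^ 2 - W.v ^ 2 + 1)) * h2 - W.v * (W.v * hK - W.u₂ * t * h3)
  · linear_combination (W.u₂ ^ 2 - W.v ^ 2 + 1) * h3
  · linear_combination (W.v * (W.u₂ ^ 2 - W.v ^ 2 + 1)) * (h4 + h2) - W.v * (W.v * hK - W.u₂ * t * h3)
  · linear_combination (W.v * (W.u₂ ^ 2 - W.v ^ 2 + 1)) * h5 + (W.v * hK - W.u₂ * t * h3)
  · linear_combination (W.v * (W.u₂ ^ 2 - W.v ^ 2 + 1)) * h6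


/-- ★★ **The row space on the mirror branch `u₂ = 0`, solved off its quartic**
`(1+v−u₁)(1+v+u₁)(1−v−u₁)(1−v+u₁) ≠ 0`: `c` is symmetric under the half-turn and solves
`c₁ = −v c₂ − u₁ t⁻¹ c₀`, `v c₃ = K₋ c₀`, `K₊ c₂ + u₁ t⁻¹ c₃ = 0` (`K± = u₁² − v² ± 1`).
[cite: Glazman2015WeightedSAW, Lemma 3.1 (proof: "solving this linear system")] -/
theorem dominoRows_iff_sym_of_u₂_eq_zero (ht : t ≠ 0) (h2 : W.u₂ = 0)
    (hq : (1 + W.v - W.u₁) * (1 + W.v + W.u₁) * (1 - W.v - W.u₁) * (1 - W.v + W.u₁) ≠ 0) :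
    DominoRows W t c ↔
      (c 6 = c 0 ∧ c 5 = c 1 ∧ c 4 = c 2 ∧ c 1 = -(W.v * c 2) - W.u₁ * t⁻¹ * c 0 ∧
        W.v * c 3 = (W.u₁ ^ 2 - W.v ^ 2 - 1) * c 0 ∧ (W.u₁ ^ 2 - W.v ^ 2 + 1) * c 2 + W.u₁ * t⁻¹ * c 3 = 0) := by
  have hti : t * t⁻¹ = 1 := mul_inv_cancel₀ ht
  rw [dominoRows_iff_of_u₂_eq_zero ht h2]
  constructor
  · rintro ⟨hW, hN, hS, hE, hN', hS'⟩
    have e1 : (c 1 - c 5) + W.v * (c 2 - c 4) + W.u₁ * t⁻¹ * (c 0 - c 6) = 0 := by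
      linear_combination hN - hS'
    have eW : (c 0 - c 6) * (1 - W.u₁ ^ 2 - W.v ^ 2) - 2 * W.u₁ * W.v * t * (c 2 - c 4) = 0 := by
      linear_combination (hW - hE) - W.u₁ * t * (hN - hS') + W.u₁ ^ 2 * (c 0 - c 6) * hti
    have eS : (c 2 - c 4) * (1 - W.u₁ ^ 2 - W.v ^ 2) - 2 * W.u₁ * W.v * t⁻¹ * (c 0 - c 6) = 0 := by
      linear_combination (hS - hN') - W.v * (hN - hS')
    have hQ0 : (c 0 - c 6) * ((1 + W.v - W.u₁) * (1 + W.v + W.u₁) * (1 - W.v - W.u₁) * (1 - W.v + W.u₁)) =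
        0 := by
      linear_combination (1 - W.u₁ ^ 2 - W.v ^ 2) * eW + (2 * W.u₁ * W.v * t) * eS +
        4 * W.u₁ ^ 2 * W.v ^ 2 * (c 0 - c 6) * hti
    have a0 : c 0 - c 6 = 0 := (mul_eq_zero.1 hQ0).resolve_right hq
    have a2 : c 2 - c 4 = 0 := by
      by_cases hD : 1 - W.u₁ ^ 2 - W.v ^ 2 = 0
      · have huv : W.u₁ * W.v ≠ 0 := by
          intro h0
          apply hq
          have : (1 + W.v - W.u₁) * (1 + W.v + W.u₁) * (1 - W.v - W.u₁) * (1 - W.v + W.u₁) =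
              (1 - W.u₁ ^ 2 - W.v ^ 2) ^ 2 - 4 * (W.u₁ * W.v) ^ 2 := by ring
          rw [this, hD, h0]; ring
        have h3 : (2 * (W.u₁ * W.v) * t) * (c 2 - c 4) = 0 := by
          linear_combination -eW + (1 - W.u₁ ^ 2 - W.v ^ 2) * a0
        rcases mul_eq_zero.1 h3 with h4 | h4
        · exfalso
          rcases mul_eq_zero.1 h4 with h5 | h5
          · rcases mul_eq_zero.1 h5 with h6 | h6
            · norm_num at h6
            · exact huv h6
          · exact ht h5
        · exact h4
      · have h3 : (c 2 - c 4) * (1 - W.u₁ ^ 2 - W.v ^ 2) = 0 := by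
          linear_combination eS + 2 * W.u₁ * W.v * t⁻¹ * a0
        exact (mul_eq_zero.1 h3).resolve_right hD
    have a1 : c 1 - c 5 = 0 := by linear_combination e1 - W.v * a2 - W.u₁ * t⁻¹ * a0
    refine ⟨by linear_combination -a0, by linear_combination -a1, by linear_combination -a2,
      by linear_combination hN, ?_, ?_⟩
    · linear_combination hW - W.u₁ * t * hN + W.v ^ 2 * a0 + W.u₁ * W.v * t * a2 +
        W.u₁ ^ 2 * c 0 * hti
    · linear_combination hS - W.v * hN + W.u₁ * W.v * t⁻¹ * a0 + W.u₁ ^ 2 * a2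
  · rintro ⟨h6, h5, h4, h1, h3, hK⟩
    refine ⟨?_, ?_, ?_, ?_, ?_, ?_⟩
    · linear_combination h3 + W.v ^ 2 * h6 + W.u₁ * W.v * t * h4 + W.u₁ * t * h1 -
        W.u₁ ^ 2 * c 0 * hti
    · linear_combination h1
    · linear_combination hK + W.v * h1 + W.u₁ * W.v * t⁻¹ * h6 + W.u₁ ^ 2 * h4
    · linear_combination h6 + h3 + W.u₁ * t * (h5 + h1) - W.u₁ ^ 2 * c 0 * hti
    · linear_combination h4 + W.v * h5 + hK + W.v * h1
    · linear_combination h5 + W.v * h4 + W.u₁ * t⁻¹ * h6 + h1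

/-- ★★ **Proportionality on the mirror branch**: `cᵢ · (v t K₊) = c₀ · (branchDominoCoeffMirror u₁ v t)ᵢ`
for all seven slots — the class off the quartic is the line `ℂ · branchDominoCoeffMirror u₁ v t`.
[cite: Glazman2015WeightedSAW, Lemma 3.1 (proof: "solving this linear system")] -/
theorem dominoRows_proportional_of_u₂_eq_zero (ht : t ≠ 0) (h2 : W.u₂ = 0)
    (hq : (1 + W.v - W.u₁) * (1 + W.v + W.u₁) * (1 - W.v - W.u₁) * (1 - W.v + W.u₁) ≠ 0)
    (hrows : DominoRows W t c) (i : Fin 7) :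
    c i * (W.v * t * (W.u₁ ^ 2 - W.v ^ 2 + 1)) = c 0 * branchDominoCoeffMirror W.u₁ W.v t i := by
  have hti : t * t⁻¹ = 1 := mul_inv_cancel₀ ht
  obtain ⟨h6, h5, h4, h1, h3, hK⟩ := (dominoRows_iff_sym_of_u₂_eq_zero ht h2 hq).1 hrows
  fin_cases i <;>
    simp only [branchDominoCoeffMirror, Matrix.cons_val_zero, Matrix.cons_val_one, Matrix.head_cons,
      Matrix.cons_val_two, Matrix.tail_cons, Matrix.cons_val_three, Matrix.cons_val, Fin.zero_eta, Fin.mk_one,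
      Fin.reduceFinMk]
  · linear_combination (W.v * t * (W.u₁ ^ 2 - W.v ^ 2 + 1)) * h1 -
      W.v * (W.v * t * hK - W.u₁ * W.v * c 3 * hti - W.u₁ * h3) - W.u₁ * W.v * (W.u₁ ^ 2 - W.v ^ 2 + 1) * c 0 * hti
  · linear_combination W.v * t * hK - W.u₁ * W.v * c 3 * hti - W.u₁ * h3
  · linear_combination t * (W.u₁ ^ 2 - W.v ^ 2 + 1) * h3
  · linear_combination (W.v * t * (W.u₁ ^ 2 - W.v ^ 2 + 1)) * h4 +
      (W.v * t * hK - W.u₁ * W.v * c 3 * hti - W.u₁ * h3)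
  · linear_combination (W.v * t * (W.u₁ ^ 2 - W.v ^ 2 + 1)) * (h5 + h1) -
      W.v * (W.v * t * hK - W.u₁ * W.v * c 3 * hti - W.u₁ * h3) - W.u₁ * W.v * (W.u₁ ^ 2 - W.v ^ 2 + 1) * c 0 * hti
  · linear_combination (W.v * t * (W.u₁ ^ 2 - W.v ^ 2 + 1)) * h6

end Necessity

/-! ## Generic triviality -/

section Generic

variable {W : CWeights} {t : ℂ} {c : Fin 7 → ℂ}

/-- ★ **The antisymmetric domino determinant** `dominoDetA = det A′ / t²`: the `3 × 3` determinant of the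
antisymmetrised, cleared two-plaquette rows — a 13-term polynomial in `u₁, u₂, v, t`, symmetric in
`u₁ ↔ u₂`, reducing to `t⁴ · (1+v−u₂)(1+v+u₂)(1−v−u₂)(1−v+u₂)` at `u₁ = 0`.
[cite: Glazman2015WeightedSAW, Lemma 3.1 (proof: the determinant of the one-rhombus linear system)] -/
def dominoDetA (W : CWeights) (t : ℂ) : ℂ :=
  t ^ 4 - 2 * W.v ^ 2 * t ^ 4 + W.v ^ 4 * t ^ 4 - 2 * W.u₂ ^ 2 * t ^ 4
      - 2 * W.u₂ ^ 2 * W.v ^ 2 * t ^ 4 + W.u₂ ^ 4 * t ^ 4 + 4 * W.u₁ * W.u₂ * W.v * t ^ 2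
      + 4 * W.u₁ * W.u₂ * W.v * t ^ 6 - 2 * W.u₁ ^ 2 * t ^ 4 - 2 * W.u₁ ^ 2 * W.v ^ 2 * t ^ 4
      - (W.u₁ ^ 2 * W.u₂ ^ 2) - (W.u₁ ^ 2 * W.u₂ ^ 2 * t ^ 8) + W.u₁ ^ 4 * t ^ 4

/-- ★ **The symmetric domino determinant** `dominoDetS = det S′ / (2u₁²u₂t³)`: the `4 × 4` determinant of the
three symmetrised cleared rows and the symmetrised `2 × 2`-block instance — a 21-term polynomial in
`u₁, u₂, v, w₁, t` (the doubled corner weight `w₁` enters through the walk circling the block).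
[cite: Glazman2015WeightedSAW, Lemma 3.1 (proof: the determinant of the one-rhombus linear system)] -/
def dominoDetS (W : CWeights) (t : ℂ) : ℂ :=
  -(W.u₂ * W.v * t ^ 10) + 2 * W.u₂ * W.v * W.w₁ * t ^ 6 - (W.u₂ * W.v ^ 3 * t ^ 10)
      + W.u₂ ^ 3 * W.v * t ^ 10 - (W.u₁ * W.w₁ * t ^ 4) + W.u₁ * W.v ^ 2 * t ^ 4
      + 2 * W.u₁ * W.v ^ 2 * t ^ 8 - (W.u₁ * W.v ^ 2 * W.w₁ * t ^ 4) - (W.u₁ * W.v ^ 4 * t ^ 4)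
      + W.u₁ * W.u₂ ^ 2 * t ^ 4 - (W.u₁ * W.u₂ ^ 2 * W.w₁ * t ^ 8)
      + 2 * W.u₁ * W.u₂ ^ 2 * W.v ^ 2 * t ^ 4 - (W.u₁ * W.u₂ ^ 4 * t ^ 4)
      - 3 * W.u₁ ^ 2 * W.u₂ * W.v * t ^ 2 - 4 * W.u₁ ^ 2 * W.u₂ * W.v * t ^ 6
      + W.u₁ ^ 3 * t ^ 4 + W.u₁ ^ 3 * W.w₁ * t ^ 4 + 2 * W.u₁ ^ 3 * W.v ^ 2 * t ^ 4
      + W.u₁ ^ 3 * W.u₂ ^ 2 + W.u₁ ^ 3 * W.u₂ ^ 2 * t ^ 8 - (W.u₁ ^ 5 * t ^ 4)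

/-- On the directed branch `u₁ = 0` the antisymmetric determinant is `t⁴` times the one-plaquette quartic
(as it must be: `PlaquetteWalkDominoRows` § line). [cite: Glazman2015WeightedSAW, Lemma 3.1 (proof: "solving this linear system")] -/
theorem dominoDetA_of_u₁_eq_zero (h1 : W.u₁ = 0) :
    dominoDetA W t = t ^ 4 * ((1 + W.v - W.u₂) * (1 + W.v + W.u₂) * (1 - W.v - W.u₂) * (1 - W.v
        + W.u₂)) := by
  rw [dominoDetA, h1]; ring

/-- The antisymmetric determinant of the uniform self-avoiding walk `(x, x, x, 0, 0)`.
[cite: GlazmanManolescu2019, §1 (the uniform walk as a point of the five-weight family)] -/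
theorem dominoDetA_saw (x t : ℂ) :
    dominoDetA ⟨x, x, x, 0, 0⟩ t = t ^ 4 - 6 * x ^ 2 * t ^ 4 + 4 * x ^ 3 * t ^ 2
        + 4 * x ^ 3 * t ^ 6 - (x ^ 4) - (x ^ 4 * t ^ 4) - (x ^ 4 * t ^ 8) := by
  rw [dominoDetA]; ring

/-- The symmetric determinant of the uniform self-avoiding walk `(x, x, x, 0, 0)`.
[cite: GlazmanManolescu2019, §1 (the uniform walk as a point of the five-weight family)] -/
theorem dominoDetS_saw (x t : ℂ) :
    dominoDetS ⟨x, x, x, 0, 0⟩ t = -(x ^ 2 * t ^ 10) + 3 * x ^ 3 * t ^ 4 + 2 * x ^ 3 * t ^ 8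
        - 3 * x ^ 4 * t ^ 2 - 4 * x ^ 4 * t ^ 6 + x ^ 5 + x ^ 5 * t ^ 4 + x ^ 5 * t ^ 8 := by
  rw [dominoDetS]; ring

/-! #### The `2 × 2` block: one instance and its half-turn image (kernel enumeration by `decide`) -/

/-- The `2 × 2` block above the domino `[(0,0), (1,0)]`. [cite: GlazmanManolescu2019, §1 (faces (k, j))] -/
def blkD : List Face := [(0, 0), (1, 0), (0, 1), (1, 1)]

/-- Its half-turn image about the centre of the domino: the `2 × 2` block below. [cite: GlazmanManolescu2019, §1 (faces (k, j))] -/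
def blkD' : List Face := [(0, 0), (1, 0), (0, -1), (1, -1)]

/-- The relation on the upper block, split into the two one-plaquette functionals. [cite: DuminilCopinSmirnov2012, Lemma 1 (linear in the coefficients)] -/
private theorem split_blkD (hrel : ExactDominoVertexRelation W t c) {a : MidEdge}
    (ha : IsBoundaryRoot blkD a) :
    vertexFunctional W t (leftCoeff c (c 3)) blkD a (0, 0) +
      vertexFunctional W t (rightCoeff c 0) blkD a (1, 0) = 0 := by
  have h := hrel blkD a (0, 0) (by simp [blkD]) (by simp [blkD, east]) ha
  rwa [dominoFunctional_eq_add W t c blkD a (0, 0) (show c 3 + 0 = c 3 by ring)] at h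

/-- The relation on the lower block, split likewise. [cite: DuminilCopinSmirnov2012, Lemma 1 (linear in the coefficients)] -/
private theorem split_blkD' (hrel : ExactDominoVertexRelation W t c) {a : MidEdge}
    (ha : IsBoundaryRoot blkD' a) :
    vertexFunctional W t (leftCoeff c (c 3)) blkD' a (0, 0) +
      vertexFunctional W t (rightCoeff c 0) blkD' a (1, 0) = 0 := by
  have h := hrel blkD' a (0, 0) (by simp [blkD']) (by simp [blkD', east]) ha
  rwa [dominoFunctional_eq_add W t c blkD' a (0, 0) (show c 3 + 0 = c 3 by ring)] at h

/-- ★ Instance on the upper `2 × 2` block from the west side of `(0,0)` (7 + 8 walks, cleared by `t³`): the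
bare row `R_W` plus the contributions of the walks circling the centre of the block — among them the walk
that DOUBLES the corner plaquette `(0,0)` (weight `w₁`). [cite: GlazmanManolescu2019, Lemma 2.1 (proof: the walks at one rhombus)] -/
private theorem instBlockW (hrel : ExactDominoVertexRelation W t c) (ht : t ≠ 0) :
    c 0 * t ^ 3 + c 2 * W.u₂ * t ^ 2 + c 3 * W.v * t ^ 3 + c 1 * W.u₁ ^ 2 * W.u₂ * W.v * t ^ 6
        + c 1 * W.u₁ * t ^ 4 + c 3 * W.u₁ ^ 3 * W.u₂ * t + c 2 * W.u₁ ^ 2 * W.u₂ * W.w₁ * t ^ 2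
        + c 6 * W.v ^ 2 * t ^ 3 + c 5 * W.u₂ * W.v * t ^ 2 + c 4 * W.u₁ * W.v * t ^ 4
        + c 4 * W.u₁ ^ 2 * W.u₂ * t ^ 2 + c 6 * W.u₁ ^ 2 * W.u₂ ^ 2 * t ^ 3
        + c 5 * W.u₁ ^ 2 * W.u₂ * W.v * t ^ 2 = 0 := by
  have hT1 : termsN blkD (Face.side (0, 0) .W) (0, 0) (depth blkD) 3 =
      [⟨2, 0, 0, 0, 0, 0, 3⟩, ⟨3, 0, 1, 0, 0, 0, 2⟩, ⟨0, 0, 0, 1, 0, 0, 3⟩, ⟨1, 2, 1, 1, 0, 0,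
          6⟩, ⟨1, 1, 0, 0, 0, 0, 4⟩, ⟨0, 3, 1, 0, 0, 0, 1⟩, ⟨3, 2, 1, 0, 1, 0, 2⟩] := by
    decide
  have hT2 : termsN blkD (Face.side (0, 0) .W) (1, 0) (depth blkD) 3 =
      [⟨2, 0, 0, 1, 0, 0, 3⟩, ⟨0, 0, 0, 2, 0, 0, 3⟩, ⟨3, 0, 1, 1, 0, 0, 2⟩, ⟨1, 1, 0, 1, 0, 0,
          4⟩, ⟨1, 2, 1, 0, 0, 0, 2⟩, ⟨2, 3, 1, 0, 0, 0, 1⟩, ⟨0, 2, 2, 0, 0, 0, 3⟩, ⟨3, 2, 1, 1,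
          0, 0, 2⟩] := by
    decide
  have h1 := vertexFunctional_mul_pow_eq_rowSumN W ht (leftCoeff c (c 3)) blkD (Face.side (0,
      0) .W) (0, 0) 3
    (by decide)
  have h2 := vertexFunctional_mul_pow_eq_rowSumN W ht (rightCoeff c 0) blkD (Face.side (0,
      0) .W) (1, 0) 3
    (by decide)
  have h := split_blkD hrel (a := Face.side (0, 0) .W) (by decide)
  have h' : vertexFunctional W t (leftCoeff c (c 3)) blkD (Face.side (0, 0) .W) (0, 0) * t ^ 3 +
      vertexFunctional W t (rightCoeff c 0) blkD (Face.side (0, 0) .W) (1, 0) * t ^ 3 = 0 := by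
    rw [← add_mul, h, zero_mul]
  rw [h1, h2, hT1, hT2] at h'
  simp only [rowSumN, List.map_cons, List.map_nil, List.sum_cons, List.sum_nil, CWeights.mono,
      pow_zero,
    pow_one, mul_one, one_mul, leftCoeff, rightCoeff, Matrix.cons_val_zero, Matrix.cons_val_one,
    Matrix.head_cons, Matrix.cons_val_two, Matrix.tail_cons, Matrix.cons_val_three, zero_mul,
    add_zero] at h'
  linear_combination h'

/-- ★ The half-turn image: instance on the lower block from the east side of `(1,0)`. [cite: GlazmanManolescu2019, Lemma 2.1 (proof: the walks at one rhombus)] -/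
private theorem instBlockE (hrel : ExactDominoVertexRelation W t c) (ht : t ≠ 0) :
    c 3 * W.v * t ^ 3 + c 0 * W.v ^ 2 * t ^ 3 + c 1 * W.u₂ * W.v * t ^ 2
        + c 2 * W.u₁ * W.v * t ^ 4 + c 2 * W.u₁ ^ 2 * W.u₂ * t ^ 2
        + c 0 * W.u₁ ^ 2 * W.u₂ ^ 2 * t ^ 3 + c 1 * W.u₁ ^ 2 * W.u₂ * W.v * t ^ 2
        + c 3 * W.u₁ ^ 3 * W.u₂ * t + c 6 * t ^ 3 + c 5 * W.u₁ ^ 2 * W.u₂ * W.v * t ^ 6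
        + c 4 * W.u₂ * t ^ 2 + c 5 * W.u₁ * t ^ 4 + c 4 * W.u₁ ^ 2 * W.u₂ * W.w₁ * t ^ 2 = 0 := by
  have hT1 : termsN blkD' (Face.side (1, 0) .E) (0, 0) (depth blkD') 3 =
      [⟨0, 0, 0, 1, 0, 0, 3⟩, ⟨2, 0, 0, 2, 0, 0, 3⟩, ⟨1, 0, 1, 1, 0, 0, 2⟩, ⟨3, 1, 0, 1, 0, 0,
          4⟩, ⟨3, 2, 1, 0, 0, 0, 2⟩, ⟨2, 2, 2, 0, 0, 0, 3⟩, ⟨1, 2, 1, 1, 0, 0, 2⟩, ⟨0, 3, 1, 0,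
          0, 0, 1⟩] := by
    decide
  have hT2 : termsN blkD' (Face.side (1, 0) .E) (1, 0) (depth blkD') 3 =
      [⟨0, 0, 0, 0, 0, 0, 3⟩, ⟨2, 0, 0, 1, 0, 0, 3⟩, ⟨3, 2, 1, 1, 0, 0, 6⟩, ⟨1, 0, 1, 0, 0, 0,
          2⟩, ⟨3, 1, 0, 0, 0, 0, 4⟩, ⟨2, 3, 1, 0, 0, 0, 1⟩, ⟨1, 2, 1, 0, 1, 0, 2⟩] := by
    decide
  have h1 := vertexFunctional_mul_pow_eq_rowSumN W ht (leftCoeff c (c 3)) blkD' (Face.side (1,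
      0) .E) (0, 0) 3
    (by decide)
  have h2 := vertexFunctional_mul_pow_eq_rowSumN W ht (rightCoeff c 0) blkD' (Face.side (1,
      0) .E) (1, 0) 3
    (by decide)
  have h := split_blkD' hrel (a := Face.side (1, 0) .E) (by decide)
  have h' : vertexFunctional W t (leftCoeff c (c 3)) blkD' (Face.side (1, 0) .E) (0, 0) * t ^ 3 +
      vertexFunctional W t (rightCoeff c 0) blkD' (Face.side (1, 0) .E) (1, 0) * t ^ 3 = 0 := by
    rw [← add_mul, h, zero_mul]
  rw [h1, h2, hT1, hT2] at h'
  simp only [rowSumN, List.map_cons, List.map_nil, List.sum_cons, List.sum_nil, CWeights.mono,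
      pow_zero,
    pow_one, mul_one, one_mul, leftCoeff, rightCoeff, Matrix.cons_val_zero, Matrix.cons_val_one,
    Matrix.head_cons, Matrix.cons_val_two, Matrix.tail_cons, Matrix.cons_val_three, zero_mul,
    add_zero] at h'
  linear_combination h'


/-! #### The generic-triviality theorem -/

/-- ★★ **Generic triviality of the domino class**: for `u₁u₂ ≠ 0`, `t ≠ 0`, if the antisymmetric and the
symmetric domino determinants do not vanish, every exact two-plaquette vertex relation is TRIVIAL
(`c = 0`). Proof: the six cleared rows (necessary for every weight system, `PlaquetteWalkDominoRows`) and the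
two `2 × 2`-block instances; antisymmetrising/symmetrising under the half-turn of the domino gives
`A′ a = 0`, `S′ s = 0`; the adjugate certificates `det(A′) a = adj(A′) A′ a = 0`, `det(S′) s = 0` are ring
identities; `det A′ = t²·dominoDetA`, `det S′ = 2u₁²u₂t³·dominoDetS`.
[cite: Glazman2015WeightedSAW, Lemma 3.1 (proof: "solving this linear system")] [cite: IkhlefCardy2009, §3 (determinant of the local linear system)] -/
theorem eq_zero_of_exactDominoVertexRelation (ht : t ≠ 0) (h1 : W.u₁ ≠ 0) (h2 : W.u₂ ≠ 0)
    (hA : dominoDetA W t ≠ 0) (hS : dominoDetS W t ≠ 0) (hrel : ExactDominoVertexRelation W t c) :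
    c = 0 := by
  obtain ⟨rW, rN, rS, rE, rN', rS'⟩ := dominoRows_of_exactDominoVertexRelation hrel ht
  have eLW : c 0 * t ^ 2 + c 2 * W.u₂ * t + c 1 * W.u₁ * t ^ 3 + c 3 * W.v * t ^ 2
      + c 6 * W.v ^ 2 * t ^ 2 + c 5 * W.u₂ * W.v * t
      + c 4 * W.u₁ * W.v * t ^ 3 = 0 := by rw [← rowLW_mul (W := W) (c := c) ht, rW, zero_mul]
  have eLN : c 1 * t ^ 2 + c 0 * W.u₁ * t + c 2 * W.v * t ^ 2 + c 3 * W.u₂ * t ^ 3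
      + c 6 * W.u₂ * W.v * t ^ 3 + c 5 * W.u₂ ^ 2 * t ^ 2
      + c 4 * W.u₁ * W.u₂ * t ^ 4 = 0 := by rw [← rowLN_mul (W := W) (c := c) ht, rN, zero_mul]
  have eLS : c 2 * t ^ 2 + c 0 * W.u₂ * t ^ 3 + c 1 * W.v * t ^ 2 + c 3 * W.u₁ * t
      + c 6 * W.u₁ * W.v * t + c 5 * W.u₁ * W.u₂
      + c 4 * W.u₁ ^ 2 * t ^ 2 = 0 := by rw [← rowLS_mul (W := W) (c := c) ht, rS, zero_mul]
  have eRE : c 6 * t ^ 2 + c 4 * W.u₂ * t + c 5 * W.u₁ * t ^ 3 + c 3 * W.v * t ^ 2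
      + c 0 * W.v ^ 2 * t ^ 2 + c 1 * W.u₂ * W.v * t
      + c 2 * W.u₁ * W.v * t ^ 3 = 0 := by rw [← rowRE_mul (W := W) (c := c) ht, rE, zero_mul]
  have eRN : c 4 * t ^ 2 + c 6 * W.u₂ * t ^ 3 + c 5 * W.v * t ^ 2 + c 3 * W.u₁ * t
      + c 0 * W.u₁ * W.v * t + c 1 * W.u₁ * W.u₂
      + c 2 * W.u₁ ^ 2 * t ^ 2 = 0 := by rw [← rowRN_mul (W := W) (c := c) ht, rN', zero_mul]
  have eRS : c 5 * t ^ 2 + c 6 * W.u₁ * t + c 4 * W.v * t ^ 2 + c 3 * W.u₂ * t ^ 3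
      + c 0 * W.u₂ * W.v * t ^ 3 + c 1 * W.u₂ ^ 2 * t ^ 2
      + c 2 * W.u₁ * W.u₂ * t ^ 4 = 0 := by rw [← rowRS_mul (W := W) (c := c) ht, rS', zero_mul]
  have b1 := instBlockW hrel ht
  have b2 := instBlockE hrel ht
  have ka0 : t ^ 2 * dominoDetA W t * (c 0 - c 6) = 0 := by
    rw [dominoDetA]
    linear_combination (t ^ 4 - (W.v ^ 2 * t ^ 4) - (W.u₂ ^ 2 * t ^ 4)
        + W.u₁ * W.u₂ * W.v * t ^ 2 + W.u₁ * W.u₂ * W.v * t ^ 6 - (W.u₁ ^ 2 * t ^ 4)) * (eLW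
        - eRE) + (2 * W.u₂ * W.v * t ^ 3 - (W.u₁ * t ^ 5) - (W.u₁ * W.v ^ 2 * t ^ 5)
        - (W.u₁ * W.u₂ ^ 2 * t) + W.u₁ ^ 3 * t ^ 5) * (eLN - eRS) +
      (-(W.u₂ * t ^ 3) - (W.u₂ * W.v ^ 2 * t ^ 3) + W.u₂ ^ 3 * t ^ 3 + 2 * W.u₁ * W.v * t ^ 5
          - (W.u₁ ^ 2 * W.u₂ * t ^ 7)) * (eLS - eRN)
  have ka1 : t ^ 2 * dominoDetA W t * (c 1 - c 5) = 0 := by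
    rw [dominoDetA]
    linear_combination (2 * W.u₂ * W.v * t ^ 5 - (W.u₁ * t ^ 3) - (W.u₁ * W.v ^ 2 * t ^ 3)
        - (W.u₁ * W.u₂ ^ 2 * t ^ 7) + W.u₁ ^ 3 * t ^ 3) * (eLW - eRE) + (t ^ 4
        - (W.v ^ 2 * t ^ 4) - (W.u₂ ^ 2 * t ^ 4) + W.u₁ * W.u₂ * W.v * t ^ 2
        + W.u₁ * W.u₂ * W.v * t ^ 6 - (W.u₁ ^ 2 * t ^ 4)) * (eLN - eRS) +
      (-(W.v * t ^ 4) + W.v ^ 3 * t ^ 4 - (W.u₂ ^ 2 * W.v * t ^ 4) + W.u₁ * W.u₂ * t ^ 2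
          + W.u₁ * W.u₂ * t ^ 6 - (W.u₁ ^ 2 * W.v * t ^ 4)) * (eLS - eRN)
  have ka2 : t ^ 2 * dominoDetA W t * (c 2 - c 4) = 0 := by
    rw [dominoDetA]
    linear_combination (-(W.u₂ * t ^ 5) - (W.u₂ * W.v ^ 2 * t ^ 5) + W.u₂ ^ 3 * t ^ 5
        + 2 * W.u₁ * W.v * t ^ 3 - (W.u₁ ^ 2 * W.u₂ * t)) * (eLW - eRE) + (-(W.v * t ^ 4)
        + W.v ^ 3 * t ^ 4 - (W.u₂ ^ 2 * W.v * t ^ 4) + W.u₁ * W.u₂ * t ^ 2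
        + W.u₁ * W.u₂ * t ^ 6 - (W.u₁ ^ 2 * W.v * t ^ 4)) * (eLN - eRS) +
      (t ^ 4 - (W.v ^ 2 * t ^ 4) - (W.u₂ ^ 2 * t ^ 4) + W.u₁ * W.u₂ * W.v * t ^ 2
          + W.u₁ * W.u₂ * W.v * t ^ 6 - (W.u₁ ^ 2 * t ^ 4)) * (eLS - eRN)
  have ks0 : 2 * W.u₁ ^ 2 * W.u₂ * t ^ 3 * dominoDetS W t * (c 0 + c 6) = 0 := by
    rw [dominoDetS]
    linear_combination (2 * W.v * t ^ 7 - 2 * W.v ^ 3 * t ^ 7 + 2 * W.u₂ ^ 2 * W.v * t ^ 7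
        - 2 * W.u₁ * W.u₂ * t ^ 5 - 2 * W.u₁ * W.u₂ * t ^ 9 + 2 * W.u₁ ^ 2 * W.v * t ^ 7
        - 2 * W.u₁ ^ 2 * W.u₂ ^ 2 * W.v * t ^ 11 + 2 * W.u₁ ^ 2 * W.u₂ ^ 2 * W.v * W.w₁ * t ^ 7
        - 2 * W.u₁ ^ 3 * W.u₂ * W.w₁ * t ^ 5 + 2 * W.u₁ ^ 3 * W.u₂ * W.v ^ 2 * t ^ 9
        + 2 * W.u₁ ^ 3 * W.u₂ ^ 3 * t ^ 5 - 2 * W.u₁ ^ 4 * W.u₂ ^ 2 * W.v * t ^ 3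
        - 2 * W.u₁ ^ 4 * W.u₂ ^ 2 * W.v * t ^ 7 + 2 * W.u₁ ^ 5 * W.u₂ * t ^ 5) * (eLW + eRE)
        + (2 * W.u₁ ^ 2 * W.u₂ * W.v ^ 2 * t ^ 10
        - 2 * W.u₁ ^ 2 * W.u₂ * W.v ^ 2 * W.w₁ * t ^ 6 - 2 * W.u₁ ^ 3 * W.u₂ ^ 2 * W.v * t ^ 4
        - 2 * W.u₁ ^ 3 * W.u₂ ^ 2 * W.v * t ^ 8 + 2 * W.u₁ ^ 4 * W.u₂ * W.w₁ * t ^ 6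
        + 2 * W.u₁ ^ 4 * W.u₂ * W.v ^ 2 * t ^ 6 + 2 * W.u₁ ^ 4 * W.u₂ ^ 3 * t ^ 2
        - 2 * W.u₁ ^ 6 * W.u₂ * t ^ 6) * (eLN + eRS) +
      (2 * W.u₁ ^ 2 * W.u₂ * W.v * t ^ 6 + 2 * W.u₁ ^ 2 * W.u₂ * W.v * W.w₁ * t ^ 6
          - 2 * W.u₁ ^ 2 * W.u₂ * W.v ^ 3 * t ^ 6 - 2 * W.u₁ ^ 2 * W.u₂ * W.v ^ 3 * t ^ 10
          + 2 * W.u₁ ^ 2 * W.u₂ ^ 3 * W.v * t ^ 6 + 2 * W.u₁ ^ 2 * W.u₂ ^ 3 * W.v * t ^ 10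
          - 2 * W.u₁ ^ 3 * W.u₂ ^ 2 * t ^ 4 - 2 * W.u₁ ^ 3 * W.u₂ ^ 2 * t ^ 8
          - 2 * W.u₁ ^ 3 * W.u₂ ^ 2 * W.w₁ * t ^ 8 + 2 * W.u₁ ^ 3 * W.u₂ ^ 2 * W.v ^ 2 * t ^ 4
          - 2 * W.u₁ ^ 3 * W.u₂ ^ 4 * t ^ 4 + 2 * W.u₁ ^ 5 * W.u₂ ^ 2 * t ^ 8) * (eLS + eRN)
          + (-2 * W.v * t ^ 6 + 2 * W.v ^ 3 * t ^ 6 - 2 * W.u₂ ^ 2 * W.v * t ^ 6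
          + 2 * W.u₁ * W.u₂ * t ^ 4 + 2 * W.u₁ * W.u₂ * t ^ 8
          - 2 * W.u₁ ^ 2 * W.v * t ^ 6) * (b1 + b2)
  have ks1 : 2 * W.u₁ ^ 2 * W.u₂ * t ^ 3 * dominoDetS W t * (c 1 + c 5) = 0 := by
    rw [dominoDetS]
    linear_combination (2 * W.u₂ * t ^ 8 + 2 * W.u₂ * W.v ^ 2 * t ^ 8 - 2 * W.u₂ ^ 3 * t ^ 8
        - 4 * W.u₁ * W.v * t ^ 6 + 2 * W.u₁ ^ 2 * W.u₂ * t ^ 4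
        - 2 * W.u₁ ^ 2 * W.u₂ ^ 3 * W.w₁ * t ^ 8 - 2 * W.u₁ ^ 3 * W.u₂ ^ 2 * W.v * t ^ 6
        + 2 * W.u₁ ^ 4 * W.u₂ * W.w₁ * t ^ 4 + 2 * W.u₁ ^ 4 * W.u₂ * W.v ^ 2 * t ^ 4
        + 2 * W.u₁ ^ 4 * W.u₂ ^ 3 * t ^ 8 - 2 * W.u₁ ^ 6 * W.u₂ * t ^ 4) * (eLW + eRE)
        + (2 * W.u₁ ^ 2 * W.u₂ ^ 2 * W.v * W.w₁ * t ^ 7 - 2 * W.u₁ ^ 3 * W.u₂ * W.w₁ * t ^ 5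
        + 2 * W.u₁ ^ 3 * W.u₂ * W.v ^ 2 * t ^ 5 - 2 * W.u₁ ^ 4 * W.u₂ ^ 2 * W.v * t ^ 3
        - 2 * W.u₁ ^ 4 * W.u₂ ^ 2 * W.v * t ^ 7 + 2 * W.u₁ ^ 5 * W.u₂ * t ^ 5) * (eLN + eRS) +
      (2 * W.u₁ ^ 2 * W.u₂ ^ 2 * t ^ 7 + 2 * W.u₁ ^ 2 * W.u₂ ^ 2 * W.w₁ * t ^ 7
          + 2 * W.u₁ ^ 2 * W.u₂ ^ 2 * W.v ^ 2 * t ^ 7 - 2 * W.u₁ ^ 2 * W.u₂ ^ 4 * t ^ 7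
          - 4 * W.u₁ ^ 3 * W.u₂ * W.v * t ^ 5 - 2 * W.u₁ ^ 3 * W.u₂ * W.v * W.w₁ * t ^ 5
          - 2 * W.u₁ ^ 3 * W.u₂ * W.v ^ 3 * t ^ 5 + 2 * W.u₁ ^ 3 * W.u₂ ^ 3 * W.v * t ^ 5
          + 2 * W.u₁ ^ 4 * W.u₂ ^ 2 * t ^ 3 - 2 * W.u₁ ^ 4 * W.u₂ ^ 2 * t ^ 7
          + 2 * W.u₁ ^ 5 * W.u₂ * W.v * t ^ 5) * (eLS + eRN) + (-2 * W.u₂ * t ^ 7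
          - 2 * W.u₂ * W.v ^ 2 * t ^ 7 + 2 * W.u₂ ^ 3 * t ^ 7 + 4 * W.u₁ * W.v * t ^ 5
          - 2 * W.u₁ ^ 2 * W.u₂ * t ^ 3) * (b1 + b2)
  have ks2 : 2 * W.u₁ ^ 2 * W.u₂ * t ^ 3 * dominoDetS W t * (c 2 + c 4) = 0 := by
    rw [dominoDetS]
    linear_combination (-4 * W.u₂ * W.v * t ^ 8 + 2 * W.u₁ * t ^ 6 + 2 * W.u₁ * W.v ^ 2 * t ^ 6
        + 2 * W.u₁ * W.u₂ ^ 2 * t ^ 10 + 2 * W.u₁ ^ 2 * W.u₂ ^ 3 * W.v * t ^ 12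
        - 2 * W.u₁ ^ 3 * t ^ 6 + 2 * W.u₁ ^ 3 * W.u₂ ^ 2 * W.v ^ 2 * t ^ 6
        - 2 * W.u₁ ^ 3 * W.u₂ ^ 4 * t ^ 6 - 2 * W.u₁ ^ 4 * W.u₂ * W.v * t ^ 4
        - 2 * W.u₁ ^ 4 * W.u₂ * W.v * t ^ 8 + 2 * W.u₁ ^ 5 * W.u₂ ^ 2 * t ^ 2) * (eLW + eRE)
        + (-2 * W.u₁ ^ 2 * W.u₂ ^ 2 * W.v ^ 2 * t ^ 11 + 2 * W.u₁ ^ 3 * W.u₂ * W.v * t ^ 9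
        - 2 * W.u₁ ^ 3 * W.u₂ * W.v ^ 3 * t ^ 5 + 2 * W.u₁ ^ 3 * W.u₂ ^ 3 * W.v * t ^ 5
        - 2 * W.u₁ ^ 4 * W.u₂ ^ 2 * t ^ 3 + 2 * W.u₁ ^ 5 * W.u₂ * W.v * t ^ 5) * (eLN + eRS) +
      (-4 * W.u₁ ^ 2 * W.u₂ ^ 2 * W.v * t ^ 7 - 2 * W.u₁ ^ 2 * W.u₂ ^ 2 * W.v * t ^ 11
          + 2 * W.u₁ ^ 3 * W.u₂ * t ^ 5 + 4 * W.u₁ ^ 3 * W.u₂ * W.v ^ 2 * t ^ 5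
          + 2 * W.u₁ ^ 3 * W.u₂ * W.v ^ 2 * t ^ 9 + 2 * W.u₁ ^ 3 * W.u₂ ^ 3 * t ^ 5
          + 2 * W.u₁ ^ 3 * W.u₂ ^ 3 * t ^ 9 - 2 * W.u₁ ^ 4 * W.u₂ ^ 2 * W.v * t ^ 3
          - 2 * W.u₁ ^ 4 * W.u₂ ^ 2 * W.v * t ^ 7 - 2 * W.u₁ ^ 5 * W.u₂ * t ^ 5) * (eLS + eRN)
          + (4 * W.u₂ * W.v * t ^ 7 - 2 * W.u₁ * t ^ 5 - 2 * W.u₁ * W.v ^ 2 * t ^ 5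
          - 2 * W.u₁ * W.u₂ ^ 2 * t ^ 9 + 2 * W.u₁ ^ 3 * t ^ 5) * (b1 + b2)
  have ks3 : 2 * W.u₁ ^ 2 * W.u₂ * t ^ 3 * dominoDetS W t * (c 3) = 0 := by
    rw [dominoDetS]
    linear_combination (-(t ^ 7) + W.v ^ 4 * t ^ 7 - 2 * W.u₂ ^ 2 * W.v ^ 2 * t ^ 7
        + W.u₂ ^ 4 * t ^ 7 + 2 * W.u₁ * W.u₂ * W.v * t ^ 5 + 2 * W.u₁ * W.u₂ * W.v * t ^ 9
        - 2 * W.u₁ ^ 2 * W.v ^ 2 * t ^ 7 - (W.u₁ ^ 2 * W.u₂ ^ 2 * t ^ 3)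
        - (W.u₁ ^ 2 * W.u₂ ^ 2 * t ^ 11) + W.u₁ ^ 2 * W.u₂ ^ 2 * W.w₁ * t ^ 7
        - (W.u₁ ^ 2 * W.u₂ ^ 2 * W.v ^ 2 * W.w₁ * t ^ 7) + W.u₁ ^ 2 * W.u₂ ^ 4 * W.w₁ * t ^ 7
        + W.u₁ ^ 3 * W.u₂ * W.v * t ^ 5 + W.u₁ ^ 3 * W.u₂ * W.v * t ^ 9
        - (W.u₁ ^ 3 * W.u₂ * W.v ^ 3 * t ^ 5) - (W.u₁ ^ 3 * W.u₂ * W.v ^ 3 * t ^ 9)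
        + W.u₁ ^ 3 * W.u₂ ^ 3 * W.v * t ^ 5 - (W.u₁ ^ 3 * W.u₂ ^ 3 * W.v * t ^ 13)
        + W.u₁ ^ 4 * t ^ 7 - (W.u₁ ^ 4 * W.u₂ ^ 2 * t ^ 3) - (W.u₁ ^ 4 * W.u₂ ^ 2 * t ^ 7)
        - (W.u₁ ^ 4 * W.u₂ ^ 2 * W.w₁ * t ^ 3) + W.u₁ ^ 5 * W.u₂ * W.v * t ^ 5
        + W.u₁ ^ 5 * W.u₂ * W.v * t ^ 9) * (eLW + eRE) + (-(W.u₁ ^ 2 * W.u₂ * W.v * t ^ 10)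
        + W.u₁ ^ 2 * W.u₂ * W.v * W.w₁ * t ^ 6 - (W.u₁ ^ 2 * W.u₂ * W.v ^ 3 * t ^ 10)
        + W.u₁ ^ 2 * W.u₂ * W.v ^ 3 * W.w₁ * t ^ 6 + W.u₁ ^ 2 * W.u₂ ^ 3 * W.v * t ^ 10
        - (W.u₁ ^ 2 * W.u₂ ^ 3 * W.v * W.w₁ * t ^ 6) + W.u₁ ^ 3 * W.u₂ ^ 2 * t ^ 4
        + W.u₁ ^ 3 * W.u₂ ^ 2 * W.w₁ * t ^ 4 - (W.u₁ ^ 3 * W.u₂ ^ 2 * W.w₁ * t ^ 8)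
        + W.u₁ ^ 3 * W.u₂ ^ 2 * W.v ^ 2 * t ^ 4 + W.u₁ ^ 3 * W.u₂ ^ 2 * W.v ^ 2 * t ^ 8
        + W.u₁ ^ 3 * W.u₂ ^ 2 * W.v ^ 2 * t ^ 12 - (W.u₁ ^ 3 * W.u₂ ^ 4 * t ^ 4)
        - 2 * W.u₁ ^ 4 * W.u₂ * W.v * t ^ 6 - (W.u₁ ^ 4 * W.u₂ * W.v * t ^ 10)
        - (W.u₁ ^ 4 * W.u₂ * W.v * W.w₁ * t ^ 6) + W.u₁ ^ 5 * W.u₂ ^ 2 * t ^ 8) * (eLN + eRS) +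
      (-(W.u₁ ^ 2 * W.u₂ * t ^ 6) - (W.u₁ ^ 2 * W.u₂ * W.w₁ * t ^ 6)
          + W.u₁ ^ 2 * W.u₂ * W.v ^ 2 * t ^ 10 - (W.u₁ ^ 2 * W.u₂ * W.v ^ 2 * W.w₁ * t ^ 6)
          + W.u₁ ^ 2 * W.u₂ * W.v ^ 4 * t ^ 6 + W.u₁ ^ 2 * W.u₂ * W.v ^ 4 * t ^ 10
          - (W.u₁ ^ 2 * W.u₂ ^ 3 * W.w₁ * t ^ 6) - 2 * W.u₁ ^ 2 * W.u₂ ^ 3 * W.v ^ 2 * t ^ 6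
          - (W.u₁ ^ 2 * W.u₂ ^ 3 * W.v ^ 2 * t ^ 10) + W.u₁ ^ 2 * W.u₂ ^ 5 * t ^ 6
          + W.u₁ ^ 3 * W.u₂ ^ 2 * W.v * t ^ 8 + W.u₁ ^ 3 * W.u₂ ^ 2 * W.v * t ^ 12
          + W.u₁ ^ 3 * W.u₂ ^ 2 * W.v * W.w₁ * t ^ 4 + W.u₁ ^ 3 * W.u₂ ^ 2 * W.v * W.w₁ * t ^ 8
          + W.u₁ ^ 4 * W.u₂ * t ^ 6 + W.u₁ ^ 4 * W.u₂ * W.w₁ * t ^ 6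
          - (W.u₁ ^ 4 * W.u₂ * W.v ^ 2 * t ^ 6) - (W.u₁ ^ 4 * W.u₂ * W.v ^ 2 * t ^ 10)
          - (W.u₁ ^ 4 * W.u₂ ^ 3 * t ^ 10)) * (eLS + eRN) + (t ^ 6 - (W.v ^ 4 * t ^ 6)
          + 2 * W.u₂ ^ 2 * W.v ^ 2 * t ^ 6 - (W.u₂ ^ 4 * t ^ 6) - 2 * W.u₁ * W.u₂ * W.v * t ^ 4
          - 2 * W.u₁ * W.u₂ * W.v * t ^ 8 + 2 * W.u₁ ^ 2 * W.v ^ 2 * t ^ 6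
          + W.u₁ ^ 2 * W.u₂ ^ 2 * t ^ 2 + W.u₁ ^ 2 * W.u₂ ^ 2 * t ^ 10
          - (W.u₁ ^ 4 * t ^ 6)) * (b1 + b2)
  have hA' : t ^ 2 * dominoDetA W t ≠ 0 := mul_ne_zero (pow_ne_zero 2 ht) hA
  have hS' : 2 * W.u₁ ^ 2 * W.u₂ * t ^ 3 * dominoDetS W t ≠ 0 :=
    mul_ne_zero (mul_ne_zero (mul_ne_zero (mul_ne_zero two_ne_zero (pow_ne_zero 2 h1)) h2)
      (pow_ne_zero 3 ht)) hS
  have a0 : c 0 - c 6 = 0 := (mul_eq_zero.1 ka0).resolve_left hA'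
  have a1 : c 1 - c 5 = 0 := (mul_eq_zero.1 ka1).resolve_left hA'
  have a2 : c 2 - c 4 = 0 := (mul_eq_zero.1 ka2).resolve_left hA'
  have s0 : c 0 + c 6 = 0 := (mul_eq_zero.1 ks0).resolve_left hS'
  have s1 : c 1 + c 5 = 0 := (mul_eq_zero.1 ks1).resolve_left hS'
  have s2 : c 2 + c 4 = 0 := (mul_eq_zero.1 ks2).resolve_left hS'
  have s3 : c 3 = 0 := (mul_eq_zero.1 ks3).resolve_left hS'
  funext i
  fin_cases i
  · show c 0 = 0
    linear_combination (s0 + a0) / 2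
  · show c 1 = 0
    linear_combination (s1 + a1) / 2
  · show c 2 = 0
    linear_combination (s2 + a2) / 2
  · show c 3 = 0
    exact s3
  · show c 4 = 0
    linear_combination (s2 - a2) / 2
  · show c 5 = 0
    linear_combination (s1 - a1) / 2
  · show c 6 = 0
    linear_combination (s0 - a0) / 2

/-- ★★ Contrapositive: a NONZERO two-plaquette identity with `u₁u₂ ≠ 0` lies on the exceptional hypersurface
`dominoDetA · dominoDetS = 0`. [cite: Glazman2015WeightedSAW, Lemma 3.1 (proof: "solving this linear system")] -/
theorem dominoDet_eq_zero_of_exists (ht : t ≠ 0) (h1 : W.u₁ ≠ 0) (h2 : W.u₂ ≠ 0)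
    (h : ∃ c : Fin 7 → ℂ, c ≠ 0 ∧ ExactDominoVertexRelation W t c) :
    dominoDetA W t = 0 ∨ dominoDetS W t = 0 := by
  obtain ⟨c, hc, hrel⟩ := h
  by_contra hne
  simp only [not_or] at hne
  exact hc (eq_zero_of_exactDominoVertexRelation ht h1 h2 hne.1 hne.2 hrel)

/-- ★ **Uniform self-avoiding walk**: in the five-weight frame `W = (x, x, x, 0, 0)`, `x ≠ 0`, `t ≠ 0`, a
nonzero two-plaquette identity forces `(x, t)` onto one of two explicit curves,
`t⁴ − 6x²t⁴ + 4x³(t² + t⁶) − x⁴(1 + t⁴ + t⁸) = 0` or `x³(1 + t⁴ + t⁸) − t¹⁰ + 3xt⁴ + 2xt⁸ − 3x²t² − 4x²t⁶ = 0`.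
[cite: GlazmanManolescu2019, §1 (the uniform walk as a point of the family)] -/
theorem saw_domino_trivial {x t : ℂ} (hx : x ≠ 0) (ht : t ≠ 0)
    (hA : t ^ 4 - 6 * x ^ 2 * t ^ 4 + 4 * x ^ 3 * t ^ 2 + 4 * x ^ 3 * t ^ 6 - (x ^ 4)
        - (x ^ 4 * t ^ 4) - (x ^ 4 * t ^ 8) ≠ 0)
    (hS : x ^ 3 + x ^ 3 * t ^ 4 + x ^ 3 * t ^ 8 - t ^ 10 + 3 * x * t ^ 4 + 2 * x * t ^ 8
        - 3 * x ^ 2 * t ^ 2 -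
      4 * x ^ 2 * t ^ 6 ≠ 0) :
    ¬∃ c : Fin 7 → ℂ, c ≠ 0 ∧ ExactDominoVertexRelation ⟨x, x, x, 0, 0⟩ t c := by
  intro h
  rcases dominoDet_eq_zero_of_exists (W := ⟨x, x, x, 0, 0⟩) ht hx hx h with hA0 | hS0
  · exact hA (by rw [dominoDetA_saw] at hA0; exact hA0)
  · apply hS
    rw [dominoDetS_saw] at hS0
    have hx2 : x ^ 2 ≠ 0 := pow_ne_zero 2 hx
    have key : x ^ 2 * (x ^ 3 + x ^ 3 * t ^ 4 + x ^ 3 * t ^ 8 - t ^ 10 + 3 * x * t ^ 4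
        + 2 * x * t ^ 8 -
        3 * x ^ 2 * t ^ 2 - 4 * x ^ 2 * t ^ 6) = 0 := by
      linear_combination hS0
    exact (mul_eq_zero.1 key).resolve_left hx2

/-- **Barrier `PlaquetteWalkDominoGenericTriviality`** (named statement): for the five-weight plaquette walk
on `ℤ²` with `u₁u₂ ≠ 0` and phase `t ≠ 0`, every nonzero exact two-plaquette (domino) vertex relation lies on
the explicit hypersurface `dominoDetA W t = 0 ∨ dominoDetS W t = 0`. A THEOREM of this file
(`PlaquetteWalkDominoGenericTriviality_holds`).

BARRIER (structured block, D-0021):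
- technique_class: two-plaquette (domino) constant-coefficient vertex relations `ExactDominoVertexRelation W t c` of the GM plaquette walk on `ℤ²` (every domino of every finite face list, every boundary root)
- blocks: every nonzero domino identity at a weight system with `u₁u₂ ≠ 0` OFF the hypersurface `{dominoDetA = 0} ∪ {dominoDetS = 0}` (13- and 21-term explicit polynomials) — in particular the uniform self-avoiding walk `(x,x,x,0,0)` off two explicit curves in the `(x,t)`-plane (`saw_domino_trivial`); together with `PlaquetteWalkDominoIdentity` (the hyperplanes `u₁u₂ = 0` DO carry identities) this locates the whole domino class inside `{u₁u₂ = 0} ∪ {dominoDetA·dominoDetS = 0}`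
- because: the six rows (`PlaquetteWalkDominoRows`) and two `2 × 2`-block instances (`decide` on the certified enumerator), antisymmetrised / symmetrised under the half-turn of the domino, have determinants `t²·dominoDetA` and `2u₁²u₂t³·dominoDetS`; adjugate certificates checked by `ring`
- evasions_known: weight systems ON the hypersurface (it contains the sixteen Yang–Baxter curves and Glazman's degenerate lines, where plaquette translates live); root-dependent coefficients; larger stencils
- scope_caveats: a necessary condition for a nonzero identity only — NOT sharp: the lane's referee face (b-ref, exact kernels at sampled points of `dominoDetS = 0`) finds the full system still trivial there generically, so «off the hypersurface the class is empty» must not be read as «on it, nonempty»; horizontal dominoes; `t = 0` excluded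
- status: established — `PlaquetteWalkDominoGenericTriviality_holds`; print: one-plaquette determinants [cite: Glazman2015WeightedSAW, Lemma 3.1] [cite: IkhlefCardy2009, §3]; the two-plaquette determinants are the venture lane's (NEW-IN-WRITING, modest)
[cite: Glazman2015WeightedSAW, Lemma 3.1] -/
def _root_.Literature.Barriers.CriticalPhenomena.PlaquetteWalkDominoGenericTriviality : Prop :=
  ∀ (W : CWeights) (t : ℂ), t ≠ 0 → W.u₁ ≠ 0 → W.u₂ ≠ 0 →
    (∃ c : Fin 7 → ℂ,
        c ≠ 0 ∧ ExactDominoVertexRelation W t c) → dominoDetA W t = 0 ∨ dominoDetS W t = 0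

/-- **`PlaquetteWalkDominoGenericTriviality` holds.** [cite: Glazman2015WeightedSAW, Lemma 3.1] -/
theorem _root_.Literature.Barriers.CriticalPhenomena.PlaquetteWalkDominoGenericTriviality_holds :
    PlaquetteWalkDominoGenericTriviality :=
  fun _ _ ht h1 h2 h => dominoDet_eq_zero_of_exists ht h1 h2 h

end Generic

/-! ## The named statements -/

/-- **Barrier `PlaquetteWalkDominoRows`** (named statement): for the five-weight plaquette walk on `ℤ²` the six
two-plaquette rows `DominoRows W t c` are NECESSARY for an exact (horizontal) domino relation, at every
weight system `W ∈ ℂ⁵` and every phase `t ≠ 0`. A THEOREM of this file (`PlaquetteWalkDominoRows_holds`);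
sufficiency on the directed branches is `PlaquetteWalkDominoIdentity`.

BARRIER (structured block, D-0021):
- technique_class: two-plaquette (domino) constant-coefficient vertex relations `ExactDominoVertexRelation W t c` of the GM plaquette walk on `ℤ²` (every domino of every finite face list, every boundary root)
- blocks: every candidate vector `c` violating one of the six rows, at ANY weight system — the analogue of the one-plaquette «group-one rows»
- because: the relation on the bare two-face list from its six boundary roots is exactly the six rows (twelve `decide` instances of the certified enumerator `termsN`)
- evasions_known: larger face lists impose further conditions (§ Generic: the `2 × 2` block); root-dependent coefficients; other stencils
- scope_caveats: horizontal dominoes; exact constant-coefficient identities of the five-weight class; `t = 0` excluded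
- status: established — `PlaquetteWalkDominoRows_holds`; print: the one-rhombus necessity [cite: Glazman2015WeightedSAW, Lemma 3.1]
[cite: Glazman2015WeightedSAW, Lemma 3.1] -/
def _root_.Literature.Barriers.CriticalPhenomena.PlaquetteWalkDominoRows : Prop :=
  ∀ (W : CWeights) (t : ℂ) (c : Fin 7 → ℂ), t ≠ 0 → ExactDominoVertexRelation W t c → DominoRows W t c

/-- **`PlaquetteWalkDominoRows` holds.** [cite: Glazman2015WeightedSAW, Lemma 3.1] -/
theorem _root_.Literature.Barriers.CriticalPhenomena.PlaquetteWalkDominoRows_holds : PlaquetteWalkDominoRows :=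
  fun _ _ _ ht h => dominoRows_of_exactDominoVertexRelation h ht

end PlaquetteWalk

end Literature.Barriers.CriticalPhenomena
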